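import Mathlib
import HarnessLib
import HarnessLib.Audit
import Summits.QuantumFields.Statement
import Literature.MathematicalPhysics.QuantumFieldTheory.TiltedTorusLatticeSchwinger
import Literature.MathematicalPhysics.QuantumFieldTheory.OSReconstructionNoE1
import Summits.QuantumFields.YangMills.Theorems.MirrorModularBoostsPlanarSpectralConeSpanLinearity
import Summits.QuantumFields.YangMills.Theorems.MirrorModularBoostsPlanarSpectralConeTransfer
import Summits.QuantumFields.YangMills.Theorems.PencilRigidityPlanarToEuclidean
import Summits.QuantumFields.YangMills.Theorems.PencilRigidityCurvatureChannel
import Summits.QuantumFields.YangMills.Theorems.MirrorModularBoostsPlanarSpectralConeDelayedLever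
import HarnessLib.Audit.Status.Attr

/-!
Route: TransparentRPWall

# Route TransparentRPWall — a Clifford-rotated reflection-positive wall gives Wilson QCD its
diagonal mirrors; sixteen mirrors and modular boosts give E1

It suffices to show X := (H) QCDHypercubicLimit ∧ (D) WallDiagonalRP ∧ (C)
LabelledPlanarSpectralCone ∧ (B) QCDBoostCovariance,
realising card transparent-rp-wall-diagonal-mirrors(-v2) ("sixteen mirrors for Wilson quarks after
all") as the QCD source of DIAGONAL
reflection positivity, joined to the sixteen-mirrors→modular-boosts E1 engine of route
MirrorModularBoosts (YangMills) restated for a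
full multi-species family. (H) = `QCD` minus the rotation half of E1 (existence, axis OS axioms,
translations, proper-hypercubic
invariance, honest lattice convergence with asymptotic scaling, dynamical quarks, continuum +
uniform lattice gap). (D) every such
gapped asymptotically-scaling lattice-QCD limit is reflection positive across the four diagonal
mirrors x₀ = ±x₁ — the positivity
Wilson quarks LACK at finite spacing (FourMirrorsWardE1.NoDiagonalFermionRP) and which the card's
exactly-RP, transparent Clifford wall
supplies. (C) model-blind: RP across the four mirror lines of a coordinate plane ⇒ the planar
spectral cone H ≥ |P₁|. (B) eight plane
frames + cone ⇒ planar-rotation invariance of every species string of a lattice-QCD limit (Borchers'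
half-sided modular boosts +
scalarity of the dimension ≤ 4 channels). FreeWallRP (crux 5) and FreeWallRPCertificate are the
wall's lattice face, typed now.
Lean: `(open Literature.MathematicalPhysics.QuantumLattice Literature.MathematicalPhysics.AQFT
Literature.MathematicalPhysics.QuantumFieldTheory in let E := EuclideanSpace ℝ (Fin 4); let W := fun
(Nf : ℕ) (sch : QCDScheme Nf) (S : LabelledSchwingerFamily (QCDField Nf) E) => ((S.IsNormalized ∧
S.IsHermitian ∧ S.HasLinearGrowth ∧ S.IsReflectionPositive ∧ S.IsSymmetric ∧ S.HasClusterProperty ∧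
(∀ (n : ℕ) (k : Fin n → QCDField Nf) (a : E) (F : SchwartzMap (Fin n → E) ℂ), IsOffDiagonal F → S n
k (translateMulti a F) = S n k F) ∧ (∀ (n : ℕ) (k : Fin n → QCDField Nf) (R : E ≃ₗᵢ[ℝ] E),
LinearMap.det (R.toLinearEquiv : E →ₗ[ℝ] E) = 1 → (∀ i : Fin 4, ∃ j : Fin 4, R
(EuclideanSpace.single i 1) = EuclideanSpace.single j 1 ∨ R (EuclideanSpace.single i 1) =
-EuclideanSpace.single j 1) → ∀ F : SchwartzMap (Fin n → E) ℂ, IsOffDiagonal F → S n k (linActMulti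
R F) = S n k F)) ∧ (sch.HasAsymptoticScaling ∧ (∀ fl : Fin Nf, ∀ᶠ k in Filter.atTop, -1 < sch.mq fl
k) ∧ (∀ (n : ℕ), n ≠ 0 → ∀ (σ : Fin n → QCDField Nf) (f : Fin n → SchwartzMap E ℝ) (F : SchwartzMap
(Fin n → E) ℂ), IsTensorOf F (fun i => ofRealTest (f i)) → IsOffDiagonal F → Filter.Tendsto (fun k :
ℕ => qcdLatticeSchwinger sch k n σ f) Filter.atTop (nhds (S n σ F)))) ∧ (∃ Δ : ℝ, 0 < Δ ∧
S.HasMassGap Δ ∧ sch.HasLatticeMassGap Δ)); let NT := fun (Nf : ℕ) (S : LabelledSchwingerFamily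
(QCDField Nf) E) (s : QCDField Nf) => (∃ (F G : SchwartzMap (Fin 1 → E) ℂ) (H : SchwartzMap (Fin (1
+ 1) → E) ℂ), IsTimeOrdered F ∧ IsTimeOrdered G ∧ IsAppendTensorOf H (osAdjoint F) G ∧ S (1 + 1)
(fun _ => s) H ≠ S 1 (fun _ => s) (osAdjoint F) * S 1 (fun _ => s) G); let NG := fun (Nf : ℕ) (S :
LabelledSchwingerFamily (QCDField Nf) E) (s : QCDField Nf) => (∃ (f g h : SchwartzMap E ℂ) (Ffgh :
SchwartzMap (Fin 3 → E) ℂ) (Fgh Ffh Ffg : SchwartzMap (Fin 2 → E) ℂ) (Ff Fg Fh : SchwartzMap (Fin 1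
→ E) ℂ), IsTensorOf Ffgh ![f, g, h] ∧ IsOffDiagonal Ffgh ∧ IsTensorOf Fgh ![g, h] ∧ IsTensorOf Ffh
![f, h] ∧ IsTensorOf Ffg ![f, g] ∧ IsTensorOf Ff ![f] ∧ IsTensorOf Fg ![g] ∧ IsTensorOf Fh ![h] ∧ S
3 (fun _ => s) Ffgh - S 1 (fun _ => s) Ff * S 2 (fun _ => s) Fgh - S 1 (fun _ => s) Fg * S 2 (fun _
=> s) Ffh - S 1 (fun _ => s) Fh * S 2 (fun _ => s) Ffg + 2 * (S 1 (fun _ => s) Ff * S 1 (fun _ => s)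
Fg * S 1 (fun _ => s) Fh) ≠ 0); ∀ Nf : ℕ, (Nf = 2 ∨ Nf = 3) → ∃ reg : QCDRegularisation Nf,
reg.HasMassScaling ∧ ∀ m : Fin Nf → ℝ, (∀ f, 0 < m f) → ∃ (z shift : QCDField Nf → ℕ → ℝ) (S :
LabelledSchwingerFamily (QCDField Nf) E), W Nf (reg.scheme m z shift) S ∧ NT Nf S QCDField.glue ∧ NG
Nf S QCDField.glue ∧ (∀ f g : Fin Nf, f ≠ g → NT Nf S (QCDField.pseudoRe f g))) ∧ (open
Literature.MathematicalPhysics.QuantumLattice Literature.MathematicalPhysics.AQFT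
Literature.MathematicalPhysics.QuantumFieldTheory in let E := EuclideanSpace ℝ (Fin 4); ∀ (Nf : ℕ)
(sch : QCDScheme Nf) (S : LabelledSchwingerFamily (QCDField Nf) E), sch.HasAsymptoticScaling → (∀ fl
: Fin Nf, ∀ᶠ k in Filter.atTop, -1 < sch.mq fl k) → (∀ (n : ℕ), n ≠ 0 → ∀ (σ : Fin n → QCDField Nf)
(f : Fin n → SchwartzMap E ℝ) (F : SchwartzMap (Fin n → E) ℂ), IsTensorOf F (fun i => ofRealTest (f
i)) → IsOffDiagonal F → Filter.Tendsto (fun k : ℕ => qcdLatticeSchwinger sch k n σ f) Filter.atTop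
(nhds (S n σ F))) → ∀ Δ : ℝ, 0 < Δ → sch.HasLatticeMassGap Δ → ∀ (R : E ≃ₗᵢ[ℝ] E) (a b : ℝ), a ^ 2 =
1 / 2 → b ^ 2 = 1 / 2 → R (EuclideanSpace.single 0 1) = a • EuclideanSpace.single 0 1 + b •
EuclideanSpace.single 1 1 → LabelledSchwingerFamily.IsReflectionPositive (fun n (k : Fin n →
QCDField Nf) => (S n k).comp (linActMulti R))) ∧ (open Literature.MathematicalPhysics.QuantumLattice
Literature.MathematicalPhysics.AQFT Literature.MathematicalPhysics.QuantumFieldTheory in let E :=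
EuclideanSpace ℝ (Fin 4); ∀ (ι : Type) (S : LabelledSchwingerFamily ι E), S.HasLinearGrowth →
S.IsSymmetric → (∀ (n : ℕ) (k : Fin n → ι) (a : E) (F : SchwartzMap (Fin n → E) ℂ), IsOffDiagonal F
→ S n k (translateMulti a F) = S n k F) → (∀ (R : E ≃ₗᵢ[ℝ] E) (a b : ℝ), a ^ 2 + b ^ 2 = 1 → (a = 0
∨ b = 0 ∨ a ^ 2 = b ^ 2) → R (EuclideanSpace.single 0 1) = a • EuclideanSpace.single 0 1 + b •
EuclideanSpace.single 1 1 → LabelledSchwingerFamily.IsReflectionPositive (fun n (k : Fin n → ι) =>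
(S n k).comp (linActMulti R))) → (∀ (n m : ℕ) (k : Fin n → ι) (k' : Fin m → ι) (F : SchwartzMap (Fin
n → E) ℂ) (G : SchwartzMap (Fin m → E) ℂ), IsTimeOrdered F → IsTimeOrdered G → ∃ Φ : ℂ × ℂ → ℂ,
DifferentiableOn ℂ Φ {w : ℂ × ℂ | |w.2.im| < w.1.re} ∧ (∀ (t b : ℝ), 0 < t → ∀ H : SchwartzMap (Fin
(n + m) → E) ℂ, IsAppendTensorOf H (osAdjoint F) (translateMulti (t • EuclideanSpace.single 0 1 + b
• EuclideanSpace.single 1 1) G) → Φ ((t : ℂ), (b : ℂ)) = S (n + m) (Fin.append (k ∘ Fin.rev) k') H)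
∧ (∀ w ∈ {w : ℂ × ℂ | |w.2.im| < w.1.re}, ∀ (HF : SchwartzMap (Fin (n + n) → E) ℂ) (HG : SchwartzMap
(Fin (m + m) → E) ℂ), IsAppendTensorOf HF (osAdjoint F) F → IsAppendTensorOf HG (osAdjoint G) G → ‖Φ
w‖ ^ 2 ≤ ‖S (n + n) (Fin.append (k ∘ Fin.rev) k) HF‖ * ‖S (m + m) (Fin.append (k' ∘ Fin.rev) k')
HG‖))) ∧ (open Literature.MathematicalPhysics.QuantumLattice Literature.MathematicalPhysics.AQFT
Literature.MathematicalPhysics.QuantumFieldTheory in let E := EuclideanSpace ℝ (Fin 4); let W := fun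
(Nf : ℕ) (sch : QCDScheme Nf) (S : LabelledSchwingerFamily (QCDField Nf) E) => ((S.IsNormalized ∧
S.IsHermitian ∧ S.HasLinearGrowth ∧ S.IsReflectionPositive ∧ S.IsSymmetric ∧ S.HasClusterProperty ∧
(∀ (n : ℕ) (k : Fin n → QCDField Nf) (a : E) (F : SchwartzMap (Fin n → E) ℂ), IsOffDiagonal F → S n
k (translateMulti a F) = S n k F) ∧ (∀ (n : ℕ) (k : Fin n → QCDField Nf) (R : E ≃ₗᵢ[ℝ] E),
LinearMap.det (R.toLinearEquiv : E →ₗ[ℝ] E) = 1 → (∀ i : Fin 4, ∃ j : Fin 4, R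
(EuclideanSpace.single i 1) = EuclideanSpace.single j 1 ∨ R (EuclideanSpace.single i 1) =
-EuclideanSpace.single j 1) → ∀ F : SchwartzMap (Fin n → E) ℂ, IsOffDiagonal F → S n k (linActMulti
R F) = S n k F)) ∧ (sch.HasAsymptoticScaling ∧ (∀ fl : Fin Nf, ∀ᶠ k in Filter.atTop, -1 < sch.mq fl
k) ∧ (∀ (n : ℕ), n ≠ 0 → ∀ (σ : Fin n → QCDField Nf) (f : Fin n → SchwartzMap E ℝ) (F : SchwartzMap
(Fin n → E) ℂ), IsTensorOf F (fun i => ofRealTest (f i)) → IsOffDiagonal F → Filter.Tendsto (fun k :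
ℕ => qcdLatticeSchwinger sch k n σ f) Filter.atTop (nhds (S n σ F)))) ∧ (∃ Δ : ℝ, 0 < Δ ∧
S.HasMassGap Δ ∧ sch.HasLatticeMassGap Δ)); ∀ (Nf : ℕ) (sch : QCDScheme Nf) (S :
LabelledSchwingerFamily (QCDField Nf) E), W Nf sch S → (∀ (R : E ≃ₗᵢ[ℝ] E) (a b : ℝ), a ^ 2 + b ^ 2
= 1 → (a = 0 ∨ b = 0 ∨ a ^ 2 = b ^ 2) → R (EuclideanSpace.single 0 1) = a • EuclideanSpace.single 0
1 + b • EuclideanSpace.single 1 1 → LabelledSchwingerFamily.IsReflectionPositive (fun n (k : Fin n →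
QCDField Nf) => (S n k).comp (linActMulti R))) → (∀ (n m : ℕ) (k : Fin n → QCDField Nf) (k' : Fin m
→ QCDField Nf) (F : SchwartzMap (Fin n → E) ℂ) (G : SchwartzMap (Fin m → E) ℂ), IsTimeOrdered F →
IsTimeOrdered G → ∃ Φ : ℂ × ℂ → ℂ, DifferentiableOn ℂ Φ {w : ℂ × ℂ | |w.2.im| < w.1.re} ∧ (∀ (t b :
ℝ), 0 < t → ∀ H : SchwartzMap (Fin (n + m) → E) ℂ, IsAppendTensorOf H (osAdjoint F) (translateMulti
(t • EuclideanSpace.single 0 1 + b • EuclideanSpace.single 1 1) G) → Φ ((t : ℂ), (b : ℂ)) = S (n +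
m) (Fin.append (k ∘ Fin.rev) k') H) ∧ (∀ w ∈ {w : ℂ × ℂ | |w.2.im| < w.1.re}, ∀ (HF : SchwartzMap
(Fin (n + n) → E) ℂ) (HG : SchwartzMap (Fin (m + m) → E) ℂ), IsAppendTensorOf HF (osAdjoint F) F →
IsAppendTensorOf HG (osAdjoint G) G → ‖Φ w‖ ^ 2 ≤ ‖S (n + n) (Fin.append (k ∘ Fin.rev) k) HF‖ * ‖S
(m + m) (Fin.append (k' ∘ Fin.rev) k') HG‖)) → (∀ (R : E ≃ₗᵢ[ℝ] E), LinearMap.det (R.toLinearEquiv :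
E →ₗ[ℝ] E) = 1 → R (EuclideanSpace.single 2 1) = EuclideanSpace.single 2 1 → R
(EuclideanSpace.single 3 1) = EuclideanSpace.single 3 1 → ∀ (n : ℕ) (k : Fin n → QCDField Nf) (F :
SchwartzMap (Fin n → E) ℂ), IsOffDiagonal F → S n k (linActMulti R F) = S n k F))`

## Assembly
Pure logic, PROVED sorry-free as `closes` in the planner's Sketch.lean (lean check rc 0; axioms
propext, Classical.choice,
Quot.sound): for N_f ∈ {2, 3} QCDHypercubicLimit gives reg with mass scaling and, per positive mass
tuple, z, shift and S with the
package; LabelledAxisFrames turns E2 + proper-hypercubic invariance into the four axis frames of the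
(x₀,x₁)-plane and WallDiagonalRP
(fed asymptotic scaling, the physical branch, the convergence clause and the lattice gap) gives the
four diagonal ones (a² = b² = 1/2
by linarith), hence all eight; LabelledPlanarSpectralCone gives the cone; QCDBoostCovariance gives
planar-rotation invariance of every
species string; PlanarToEuclidean upgrades proper-hypercubic + planar to every determinant-one
isometry, so S.IsEuclideanInvariant;
T := ⟨S, E0, E0', E1, E2, E3, E4⟩ : OSData (QCDField N_f) 4 has T.schwinger = S definitionally and
IsQCDAlong (scaling, branch,
convergence), the three non-triviality clauses, T.HasMassGap Δ and the lattice gap are the clauses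
in hand: QCDOf 2 ∧ QCDOf 3 = QCD.
FreeWallRP and FreeWallRPCertificate are the lattice face of WallDiagonalRP (its U ≡ 1 case and
first certificate), deliberately
not hypotheses of `closes`.

Rationale: WHY THIS LINE. Boosts are the one spacetime symmetry positivity alone manufactures (Borchers1992,
Borchers1996, BrunettiGuidoLongo2002,
BuchholzEtAl2000): after OS reconstruction a Euclidean rotation of the (x₀,x₁)-plane is a boost at
imaginary rapidity, and the lattice
data this needs are reflection positivity across the DIAGONAL mirrors x₀ = ±x₁ (the Euclidean shadow
of the wedge) plus the axis ones.
For pure Yang–Mills the plaquette action is diagonally RP on free boxes (FrohlichIsraelLiebSimon1978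
cone; route MirrorModularBoosts),
but Wilson QUARKS destroy it for every ultralocal lift (FourMirrorsWardE1, kit j000711;
MontvayMunster1994 §4.2.3 is axis-only) — the
card's move is to re-spin the Wilson projectors (1 ∓ γ_μ) ↦ (1 ∓ γ_n) on the hops touching ONE
diagonal site-hyperplane, which makes
lattice QCD exactly Θ_σ-RP there (|κ| < 1/4; free case verified this session, kit j001443) and to
let the continuum limit erase the
wall, a codimension-1 Symanzik defect with a single marginal, tree-level-absent coupling
(Symanzik1983, LuscherEtAl1992, Sint2011 for
the boundary-rotation cousin). Imported areas: reflection positivity / transfer matrices for lattice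
fermions (Luscher1977,
OsterwalderSeiler1978, MenottiPelissetto1987), modular localisation of standard subspaces (the
engine), several complex variables
(Siciak–Zaharjuta cross theorem, JarnickiPflug2011) for the cone, Symanzik boundary power counting
for transparency. Versus the open
QCD E1 lines: FourMirrorsWardE1 bets on the rotation Ward identity with k-uniform a²-insertion
bounds and no positivity on the way,
GradientFlowSpecies on flowed species; here E1 is exact positivity + transparency of a wall +
modular theory; negatives index empty.

RANKED CRUXES. #2 WallDiagonalRP (support since rev 18: DERIVED — crux-strategist BC2 redirect
2026-08-17 (cstrat-10466) into #2 WallTransparency (stmt-QuantumFields-17994, crux, THE BET: the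
wall approximants on the FILS 45° cover converge to the SAME S), #3 CoverWallRP
(stmt-QuantumFields-17995, crux, XL: EXACT swap reflection positivity of wall-modified lattice QCD
on the 45° cover, read on smeared species strings) and DiagonalRPClosure (stmt-QuantumFields-17996,
support r9, provable-now labelled port of the LANDED YangMills
RpClosure.isReflectionPositive_pullback); assembly WallDiagonalRP_of_pieces kernel-checked, inlined
in `closes` and published as Cruxes/WallDiagonalRP/Split.lean; certificate
Cruxes/WallDiagonalRP/BC2-REDIRECT.md; one registered skeleton per piece under
Cruxes/WallDiagonalRP/Lines/) — (D) THE RP-WALL CRUX (card K1+K2 read at the level of the limit).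
For every N_f, every sequential lattice-QCD scheme sch with two-loop asymptotic scaling and bare
Wilson masses eventually on the physical branch m_f(k) > −1, every labelled Schwinger family S over
the species QCDField N_f that is the k → ∞ limit of the honest `qcdLatticeSchwinger sch k` on
off-diagonal tensor test functions, and every uniform lattice mass gap Δ > 0 of sch
(`HasLatticeMassGap`): S is reflection positive in pull-back form (tree E2 of n k ↦ 𝔖ₙᵏ ∘
linActMulti R) for every frame R with R e₀ = a e₀ + b e₁, a² = b² = 1/2 — the four oriented DIAGONAL
mirrors x₀ = ±x₁. Intended engine (the card's mechanism, foreseen layer-2 children): (i)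
InteractingWallRP — lattice QCD with Wilson's SU(3) plaquette action and N_f WALL-MODIFIED Wilson
quarks (the hops touching the site hyperplane W₀ = {x₀ = x₁} in directions 0, 1 re-spun (1 ∓ γ_μ) ↦
(1 ∓ γ_n), γ_n = (γ₀ − γ₁)/√2, sign by the normal component of the hop; nothing else changes) on
σ-symmetric volumes is EXACTLY Θ_σ-reflection positive for |κ_f| < 1/4 and every β ≥ 0
(Montvay–Münster (4.99)–(4.111) on the oblique mirror: S₊ sees only ξ_n = ½(1+γ_n)ψ; B_σ = 1 − K·(4
on-wall hops), ‖1 − B_σ‖ ≤ 4|κ|; pierced plaquettes by the FILS cone); (ii) WallTransparency — the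
wall is a codimension-1 Symanzik defect whose only non-irrelevant coupling ψ̄ψ|_{W₀} is absent at
tree level and O(g₀²(a)) radiatively, so wall theory and honest scheme share the limit on off-wall
supports (b.c.-insensitivity from the uniform gap); (iii) pull-back RP is closed under limits.
FreeWallRP is the U ≡ 1 face of (i). [difficulty: XL] (why it might fail: Transparency needs the
induced wall mass ψ̄ψ|_W to stay O(g₀²) (marginal; untuned rate (log 1/a)^(−5/9)) — a locally
critical wall (layer-Aoki condensate, wall bound states) is opaque; the oblique factorisation with
links inside B_σ is unrun; torus→wall-box comparison needs b.c.-insensitivity.) [MontvayMunster1994,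
Luscher1977, OsterwalderSeiler1978, MenottiPelissetto1987, Symanzik1983, LuscherEtAl1992,
SharpeSingleton1998, Aoki1984WilsonPhase, FrohlichIsraelLiebSimon1978, kit:j001443]
#3 QCDBoostCovariance (crux) — (B) THE ENGINE — QCD twin of
MirrorModularBoosts.CurvatureBoostCovariance (YangMills) for the FULL species family, since `QCD`
cannot renormalise the quark bilinears to zero. For every N_f, scheme sch and labelled family S
carrying the package W (E0, E0', E2, E3, E4; translation and proper-hypercubic invariance on ⁰𝒮;
asymptotic scaling, physical branch and convergence of honest lattice QCD along sch to S; a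
continuum gap S.HasMassGap Δ and the uniform lattice gap, Δ > 0): if S is reflection positive in
pull-back form for the eight frames whose time axis is ±e₀, ±e₁, (±e₀ ± e₁)/√2 and has the labelled
planar spectral cone (verbatim the conclusion of LabelledPlanarSpectralCone at ι = QCDField N_f),
then EVERY species string of S is invariant on ⁰𝒮 under every determinant-one linear isometry fixing
e₂ and e₃ (all rotations of the (x₀,x₁)-plane, all n-point functions, all labels). Intended proof:
e₀-reconstruction; cone ⇒ lightlike half-sided translations + wedge Reeh–Schlieder; wedge
standardness (E3 + slit analyticity across the diagonal mirrors); Borchers1992 /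
BrunettiGuidoLongo2002 boost relations; geometric action of the three axis-wedge modular groups
closes to a covariant representation of P↑₊ (Borchers1996 Thm 4.10, BuchholzEtAl2000, Kuckert1997);
SCALARITY: the glue channel (dimension 4, mixing only with the dimension-3 scalar ψ̄ψ) and the
pseudoscalar densities ψ̄_f iγ₅ψ_g (dimension 3) are boost-(pseudo)scalars because the first
hypercubic-only gauge-invariant operators of their channels have dimension 6 (Σ_μ tr(D_μF_μν)²,
ψ̄γ₅Σ_μγ_μD_μ³ψ; LuscherWeisz1985, Symanzik1983) and die like a² along an asymptotically scaling
scheme; boosts at imaginary rapidity are the planar Euclidean rotations (OsterwalderSchrader1973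
§4.2 backwards, BHW). [deps: LabelledPlanarSpectralCone, WallDiagonalRP] [difficulty: XL] (why it
might fail: Axis-wedge modular groups need not act geometrically (Yngvason1994; GaierYngvason2000:
for GFFs geometric action ⇔ Lorentz covariance); BDFS want a transitive wedge family; and net
covariance ≠ scalarity of glue AND ψ̄γ₅ψ: the dimension-6 hypercubic admixtures must die
non-perturbatively.) [Borchers1992, Borchers1996, BrunettiGuidoLongo2002, BuchholzEtAl2000,
Kuckert1997, Yngvason1994, GaierYngvason2000, BisognanoWichmann1975, LuscherWeisz1985,
OsterwalderSchrader1973, Haag1996]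
#4 LabelledPlanarSpectralCone (support since rev 8: DERIVED — crux-strategist split 2026-08-17 into
#4 LabelledConeChainDensity (stmt-QuantumFields-18619, labelled density of cone-chain field vectors)
and #5 LabelledConeDiscSections (stmt-QuantumFields-18618, labelled front end: disc sections with a
t-uniform bound), glue LabelledPlanarSpectralCone_of_subs kernel-checked and inlined in `closes` (e₀
reconstruction + the LANDED label-generic stub_linearity / stub_cone_of_discSections /
Contraction.contractionFamily of the PROVED one-species sibling
MirrorModularBoosts.PlanarSpectralCone, stmt-QuantumFields-9664); CANDIDATE PROOFS of both pieces
and of this node (labelled ports of the sibling line, lean check rc0, 0 sorries, axioms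
propext/Classical.choice/Quot.sound) are attached as evidence and sit in
Cruxes/LabelledPlanarSpectralCone/{Proof.lean, Lines/piece1_…, Lines/piece2_…} awaiting a prover to
land them under Theorems/) — (C) MODEL-BLIND, ANY LABEL TYPE — the labelled form of
MirrorModularBoosts.PlanarSpectralCone (which it implies at ι = Unit; one proof serves both routes):
a labelled Schwinger family S on ℝ⁴ with E0' (linear growth), E3 (symmetry, labels travelling with
arguments) and translation invariance on ⁰𝒮, reflection positive in pull-back form for every frame R
with R e₀ ∈ {a e₀ + b e₁ : a² + b² = 1, a = 0 ∨ b = 0 ∨ a² = b²} (the four mirror LINES x₀ = 0, x₁ =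
0, x₀ = ±x₁ of the (x₀,x₁)-plane, both sides), has for all time-ordered F (n points, labels k) and G
(m points, labels k') a function Φ holomorphic on {(ζ,β) ∈ ℂ² : |Im β| < Re ζ} with Φ(t,b) =
𝔖_{n+m}^{rev k ++ k'}(ΘF* ⊗ G_{t e₀ + b e₁}) for t > 0, b ∈ ℝ (any tensor witness) and ‖Φ(ζ,β)‖² ≤
‖𝔖_{2n}(ΘF* ⊗ F)‖·‖𝔖_{2m}(ΘG* ⊗ G)‖ — i.e. ⟨Ψ_F, e^(−ζH + iβP₁)Ψ_G⟩ is a contraction family and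
spec(H, P₁) ⊂ {E ≥ |p₁|} on the OS space of ALL species (speed of light exactly 1, forced by the 45°
mirrors). Intended proof as in MMB: the two diagonal RPs give separate holomorphy on a cross in (u,
u') = ((x₀+x₁)/√2, (x₀−x₁)/√2); Siciak–Zaharjuta extends to {|arg u| + |arg u'| < π/2} ⊃ the light
cone; Phragmén–Lindelöf + Paley–Wiener. Labels only make the positive kernels matrix-valued.
[difficulty: L] (why it might fail: Axis RP alone fails (product-OU field: flat shell E ≡ m); the
cross theorem gives holomorphy, but the UNIFORM contraction bound on the whole cone needs edge
growth control for distributions (smearing in spectator variables) and may cost an ε of opening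
angle.) [OsterwalderSchrader1973, OsterwalderSchrader1975, GlimmJaffe1987, JarnickiPflug2011,
FrohlichIsraelLiebSimon1978, arXiv:1802.09037]
#5 FreeWallRP (crux) — THE WALL AT U ≡ 1 (card P1, all boxes and masses) — the constructive
complement of FourMirrorsWardE1.NoDiagonalFermionRP in the SAME kernel convention. For every m > 0
and every open box {0,…,n−1}⁴, n ≥ 3 (wrap-free principal submatrix of the tree's torus
`wilsonDirac`, trivial gauge group, one colour, r = 1), let D_w be the WALL-MODIFIED operator: the
entries of the hops touching W₀ = {x₀ = x₁} in directions 0 and 1 are −½(1 − γ_n) for q = p + e₀ and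
q = p − e₁, −½(1 + γ_n) for q = p − e₀ and q = p + e₁ (γ_n = (γ₀ − γ₁)/√2; sign = sign of the normal
component of the hop), every other entry Wilson's; then the one-particle Osterwalder–Schrader kernel
across the diagonal mirror θ = (x₀ ↔ x₁) with lift γ_n, K((x,α),(y,α')) = −Σ_β D_w⁻¹((y,α'),(θx,β))
(γ_n)_{βα} on Λ₊ = {x₁ < x₀}, is HERMITIAN and NEGATIVE SEMIDEFINITE — the sign in which the axis
control (lift γ₀) and hence physical reflection positivity appear in this convention (kit j001443),
while NoDiagonalFermionRP denies Hermitian-and-semidefinite for the unmodified operator with ANY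
lift. Verified numerically on 3⁴, 4⁴, 5⁴ × m ∈ {0.3, 1, 3} (kit j001443, § Numbers). Intended proof:
Montvay–Münster (4.100)–(4.111) with ξ_n, η_n, B_σ (4 on-wall neighbours, ‖1 − B_σ‖ ≤ 4|κ| < 1), or
momentum-space analysis in the wall-parallel directions plus a transfer operator across the three
wall layers. [difficulty: M] (why it might fail: Only 3⁴–5⁴ × three masses checked; M–M's site proof
uses a γ-basis adapted to ONE axis and K ≥ 0, while here on-wall tangential hops carry γ₂, γ₃ and
wall-touching hops lost their γ_t part — an indefinite or non-Hermitian remainder could surface on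
large/anisotropic boxes or as m ↓ 0.) [MontvayMunster1994, Luscher1977, OsterwalderSeiler1978,
MenottiPelissetto1987, kit:j001443]
#6 HonestLatticeLimit (crux) + GappedLimitClosure (support only because of the 7-crux cap; open, XL)
— the two halves of (H) THE EXISTENCE LEG QCDHypercubicLimit (`QCD` minus rotations plus
proper-hypercubic invariance; support since rev 13: DERIVED — crux-strategist BC2 redirect
2026-08-17, glue QCDHypercubicLimit_of_pieces inlined in `closes` rev 15, certificate
Cruxes/QCDHypercubicLimit/BC2-REDIRECT.md). Seam LATTICE PACKAGE ⟹ OS CLOSURE, line-neutral (the cut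
of the registered birth skeletons of FourMirrorsWardE1.QCDModuloRotations and
GapBuysCauchyRate.ConvergentOSClosure; every existence route of the sub outputs the package).
HonestLatticeLimit = ∃ reg (mass scaling, chiral at zero) ∀ m > 0 ∃ z shift S: E0-normalisation,
E0', E3, translations + proper signed permutations on ⁰𝒮, two-loop AF, physical branch, honest
lattice convergence to S, uniform lattice gap Δ > 0, S-level species witnesses [difficulty:
open-problem] (why it might fail: still the constructive core — no UV-stable 4D SU(3) with dynamical
Wilson quarks, no engine for the volume-uniform gap through the crossover, Goldstone gaplessness
imported, convergence for all m at once) [JaffeWitten2000, OsterwalderSeiler1978,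
MontvayMunster1994, Balaban1989LargeFieldII, MagnenRivasseauSeneor1993]. GappedLimitClosure = ∀
gapped two-loop-AF honest lattice limits: hermitian ∧ RP ∧ clustering ∧ S.HasMassGap Δ at the
lattice rate (why it might fail: HasLatticeMassGap bounds fixed observable pairs, not the
k-dependent smeared fields; RP needs S→∞ before k→∞ for the time-periodic torus functional)
[OsterwalderSchrader1975, GlimmJaffe1987, Luscher1977]. Skeleton
Cruxes/QCDHypercubicLimit/Lines/split.lean: stub_uniformLatticeData (pure lattice currency, no
convergence, no continuum object) + stub_subladderLimit (compactness, one sub-ladder for all masses)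
⇒ HonestLatticeLimit; three closure stubs shared verbatim with the sibling skeletons ⇒
GappedLimitClosure.
#9 LabelledAxisFrames (support) — MODEL-BLIND TRANSPORT, any label type (the axis-frame case of
MirrorModularBoosts.MirrorTransport, labelled; provable now): E2 of S and invariance of S on ⁰𝒮
under the proper signed permutations imply that S is reflection positive in pull-back form for every
frame R with R e₀ = a e₀ + b e₁, a² + b² = 1, a = 0 ∨ b = 0 (time axis ±e₀ or ±e₁): R = g ∘ R′ with
g a proper signed permutation moving e₀ to R e₀ and R′ fixing e₀; isometries fixing e₀ preserve
IsTimeOrdered and commute with the OS adjoint and with tensor witnesses; linActMulti is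
multiplicative (linActMulti_apply). [difficulty: provable-now] [OsterwalderSchrader1973,
GlimmJaffe1987]
#9 PlanarToEuclidean (support) — EXACT GROUP THEORY, any label type — VERBATIM the item
PlanarToEuclidean of route MirrorModularBoosts (YangMills sub; shared by signature, one proof serves
both): invariance on ⁰𝒮 under the proper signed permutations and under every determinant-one
isometry fixing e₂, e₃ implies invariance under every determinant-one linear isometry of ℝ⁴ (the
invariance set is a subgroup; conjugating SO(2)₀₁ by proper signed permutations gives all six
coordinate SO(2)'s; Givens rotations generate SO(4) exactly). [difficulty: provable-now]
[OsterwalderSchrader1973, Haag1996]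
#9 FreeWallRPCertificate (support) — THE CHEAPEST CERTIFIED INSTANCE of FreeWallRP (the mirror image
of FourMirrorsWardE1.NoDiagonalFermionRPUnitMass): m = 1, open box 3⁴. Exact linear algebra over
ℚ(√2, i): D_w is 324 × 324, K is 108 × 108; kit j001443: Hermiticity defect 8.7·10⁻¹⁸, spectrum
[−0.0686, +2.5·10⁻¹⁷] (unmodified: [−0.049, +0.0037]). A prover certifies K = Kᴴ from the
Θ_σ-covariance of D_w and −K ⪰ 0 by an exact LDLᴴ factorisation over ℚ(√2)(i) (or a rational
Cholesky factor of −K − ε·1 plus a norm bound). [difficulty: provable-now] [kit:j001443,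
MontvayMunster1994]

TWO-LAYER PLAN. WallDiagonalRP ⇐ CoverWallRP → WallTransparency → DiagonalRPClosure → WallDiagonalRP
(k = 3, FILED 2026-08-17 by the crux-strategist as add-items + re-certified `closes`, rev 18–21,
`--split` being refused outside a final cycle): the card's mechanism on three objects — the EXACT
swap positivity of the wall-modified theory on the boundaryless σ-symmetric volume on which Wilson's
weight IS swap-RP (the FILS 45° cover T̃_{2L_k+1}, Literature TiltedTorusLatticeSchwinger; the cubic
torus has a glide seam), the TRANSPARENCY of the wall (wall approximants converge to the same S; its
two stubs: torus-vs-cover volume-shape insensitivity = the QCD twin of YangMills T⁺, and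
wall-vs-honest quarks on the cover = the marginal-defect bet), and the MODEL-BLIND closure of
diagonal RP under such limits (any label type, any approximants; frame normal form + transport
inside). The Grassmann-level InteractingWallRP (Θ_σ on the boxed algebra, |κ_f| < 1/4, β ≥ 0) is now
the intended proof of CoverWallRP's hardest stub stub_exactWallTensorRP rather than an item;
FreeWallRP (support since rev 18) stays as the U ≡ 1 face and kill criterion; FreeWallRPCertificate,
LabelledAxisFrames (proved inline in closes) and GaugeWallRP were unlisted at rev 19 for the item
cap. QCDBoostCovariance ⇐ AxisWedgeStandardnessQCD → ModularBoostScalarity → QCDBoostCovariance (k =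
2), the twin of MMB's foreseen split,
after the shared definition requests land, with the milestone support SpectrumLorentzInvariantQCD
(Borchers' relations alone:
every stable hadron shell of a sixteen-mirror limit is an exact hyperboloid).
LabelledPlanarSpectralCone ⇐ LabelledConeDiscSections → LabelledConeChainDensity →
LabelledPlanarSpectralCone (k = 2, FILED 2026-08-17 by the crux-strategist as add-items +
re-certified `closes`, because `route edit --split` is refused outside a final cycle): the labelled
twin of the proved sibling's top cut (front end / density), NOT the CrossHolomorphy →
ConeContraction split foreseen at open — the sibling line positivity-disc-to-operator-cone bypassed
the cross theorem (joint spectral measures + Lukacs lever + sector engine at opening π/2 + Thales).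
QCDHypercubicLimit ⇐ HonestLatticeLimit → GappedLimitClosure → QCDHypercubicLimit (k = 2, FILED
2026-08-17 as add-items + re-certified `closes`, rev 15; `--split` refused outside a final cycle;
children.json attached to stmt-17272).

KILL CRITERIA. ¬FreeWallRP (a box and mass with an indefinite or non-Hermitian wall kernel in the
typed convention) kills the mechanism: close
`refuted:FreeWallRP` — QCD then has no lattice source of diagonal RP and E1 reverts to
FourMirrorsWardE1's Ward engine.
¬WallDiagonalRP can only come through a gapped asymptotically-scaling limit violating diagonal RP,
which would sink O(4)-invariance of
gapped Wilson-QCD limits altogether (every hypercubic-scalar species of an O(4)-invariant RP theory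
is diagonal-RP): pivot to
scheme-restricted statements and report the witness to every lattice route.
¬LabelledPlanarSpectralCone (a model-blind Gaussian
counterexample — shared kill with MMB.PlanarSpectralCone) ⇒ `refuted:LabelledPlanarSpectralCone`
unless an ε-opening-angle restate
survives. The layer-2 engine of QCDBoostCovariance shown false for a sixteen-mirror-RP local net
with the cone (a GaierYngvason2000-type
generalised free field) ⇒ close `exhausted` unless a QCD-specific source of wedge duality is named
in the grace window.
HonestLatticeLimit refuted is ¬QCD in all but name (QCD ⇒ it); ¬GappedLimitClosure (an honest gapped
lattice limit not RP or not gapped at the lattice rate) re-types the closure of every existence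
route (rate loss / antiperiodic fermions), it does not kill this line. E1 for QCD landed by
FourMirrorsWardE1 or GradientFlowSpecies ⇒ `superseded`.

NOT DECOMPOSED YET. The lattice objects of the engine — wall-modified `diracMatrix`, σ-symmetric
wall volumes, Θ_σ with lift γ_n on the boxed Grassmann
algebra, the diagonal RP predicate — are definition requests (below); InteractingWallRP and
WallTransparency are layer-2 children of
WallDiagonalRP; the operator-algebraic layer of QCDBoostCovariance (standard subspaces, half-sided
modular inclusions, OS
reconstruction without E1) waits for MMB's shared definitions; the scalarity step (dimension-6
hypercubic operators of the glue and
pseudoscalar channels) sits inside the engine, deliberately not an item; the SCV cross lemma; the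
wall counterterm c_w(k) and the rate
((log)^(−5/9) untuned vs O(a) tuned); everything about UV stability and the gap (QCDHypercubicLimit
undivided and shared in substance). (Updates 2026-08-17: LabelledPlanarSpectralCone IS decomposed
and candidate-proved, #4; QCDBoostCovariance and QCDHypercubicLimit are DERIVED from their filed
pieces, #3/#6; WallDiagonalRP is DERIVED from CoverWallRP ∧ WallTransparency ∧ DiagonalRPClosure
since rev 20 — every summit-weight node of the route is now divided at item level; what remains
undivided is inside stubs: the Grassmann wall-RP identity, the two transparency halves, the labelled
closure port.)

CHEAPEST FALSIFIER. Run this session — kit j001443 (numpy, exact inversion; `wallcheck.py` in the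
planner folder builds the operator EXACTLY as typed in
FreeWallRP): open 3⁴, 4⁴, 5⁴ boxes at m = 0.3, 1, 3; the unmodified control reproduces
FourMirrorsWardE1's j000711 to three digits
([−0.049, +0.0037] at 3⁴ m = 1, [−0.236, +0.0174] at 5⁴ m = 0.3), the wall-modified kernel is
Hermitian to 2·10⁻¹⁷ with max
eigenvalue ≤ 2.2·10⁻¹⁶ in all seven cases (negative semidefinite — the sign of the axis control, max
≤ 1.2·10⁻¹⁶), i.e. the Clifford
rotation restores definiteness where every lift of the unmodified operator fails. Next cheapest for
a refuter: (i) FreeWallRP on larger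
and anisotropic boxes and m ↓ 0 (minutes each); (ii) β = 0 on a 2⁴–3⁴ σ-symmetric box with exact
one-link integration — InteractingWallRP
as a finite Haar/Grassmann identity; (iii) one-loop lattice perturbation theory of the induced
ψ̄ψ|_W coefficient (a power divergence
instead of O(g₀²) kills transparency); (iv) the shared Gaussian test of the planar cone (MMB: every
separable completely-monotone
candidate already fails diagonal RP).

NUMBERS. Wall bound |κ| < 1/4 ⟺ m₀ > −2 (B_σ has 4 on-wall neighbours, ‖1 − B_σ‖ ≤ 4|κ|) vs
Montvay–Münster's axis bound |κ| < 1/6 ⟺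
m₀ > −1 (6 neighbours); the physical branch m_f(k) > −1 of `IsQCDAlong` lies in both. γ_n = (γ₀ −
γ₁)/√2, γ_n² = 1. Mirrors:
16 = 4 axis + 12 diagonal hyperplanes of W(B₄); per coordinate plane 8 oriented unit normals. Wall
power counting: wall dimension 3; gauge-invariant wall scalars of engineering dimension ≤ 3 even
under the surviving
symmetries: span{1, ψ̄ψ}; RG strength of the induced marginal coupling λ·(log 1/aΛ)^(γ₀/2β₀):
exponent 4/9 − 1 = −5/9 (N_f = 3),
12/29 − 1 (N_f = 2) (massExponent of QCDOS). kit j001443 [min, max eigenvalue], wall-modified, lift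
γ_n: 3⁴: [−0.0686, 2.5e−17]
(m = 1), [−0.133, 3.8e−17] (0.3), [−0.0177, 1.0e−17] (3); 4⁴: [−0.103, 4.6e−17] (1), [−0.220,
9.1e−17] (0.3); 5⁴: [−0.131, 7.6e−17]
(1), [−0.304, 2.2e−16] (0.3); Hermiticity defects ≤ 2.2e−17. Card's jobs: j001195/j001196 (free d =
2, 4), j001343/j001345 (σ-symmetric SU(3)
backgrounds, definite to 7·10⁻¹⁶), j001264 (tree-level transparency ≈ O(a)). Items at open: 9 (5
cruxes, 3 supports incl. the shared PlanarToEuclidean, 1 assembly).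

DEFINITION REQUESTS. - rpWallDiracMatrix / qcdWallLatticeSchwinger (topic
Literature/MathematicalPhysics/QuantumFieldTheory, beside QCDOS and
  QCDTimeReflection): the N_f-flavour wall-modified Wilson–Dirac matrix for the diagonal site mirror
σ = (x₀ ↔ x₁) in an SU(3)
  background, on σ-symmetric volumes (open in x₀, x₁ / rotated tori), its Berezin × Haar functional
and the smeared species n-point
  functions — needed to type the layer-2 children InteractingWallRP and WallTransparency of
WallDiagonalRP (filed `--kind definition
  --for <WallDiagonalRP item>` right after open).
- fermiThetaDiag / QCDDiagonalReflectionPositivity (same topic): the antilinear order-reversing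
reflection Θ_σψ(x) = ψ̄(σx)γ_n,
  Θ_σψ̄(x) = γ_nψ(σx) on the boxed Grassmann algebra, cfgReflect for σ, osAdjointDiag on
QCDLatticeObservable and the predicate
  ⟨Θ_σ(A)A⟩ ≥ 0 — the diagonal twin of QCDTimeReflection.lean.
- Shared with MirrorModularBoosts (requested there): OSReconstructionNoE1,
StandardSubspaceModularData.

Novelty: Searches (2026-08-15): `lit search --source crossref "reflection positivity hyperplane Wilson
fermions modified action transfer matrix"` (12: Kikukawa–Usui 2010 doi:10.1103/physrevd.82.114503 RP
of free overlap fermions — axis; Hayajneh 'Twisted reflection positivity' thesis; Palumbo 2002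
doi:10.1103/physrevd.66.077503 KS transfer matrix; Baaquie 1986; Eguchi–Kawamoto 1984
doi:10.1016/0550-3213(84)90010-5 improved Wilson action; Neeb–Ólafsson 2018 — none oblique, none
action-modifying for positivity); `lit search --source zbmath "reflection positivity oblique
diagonal hyperplane lattice fermions"` (0); `lit galaxy search --star all` "reflection positivity
across diagonal" / "oblique reflection positivity" / "reflection positive wall" (0/0/0) and
"site-reflection positivity" (1: Montvay–Münster, panama:491919784280120 — the transplanted proof);
`lit galaxy search --star pdf "rotated Schrödinger functional"` (3: χSF renormalisation papers,
arXiv:2309.04314, arXiv:2003.05781 — time-BOUNDARY projector rotation for O(a) improvement, Sint's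
lineage); tree read in full: FourMirrorsWardE1.lean, MirrorModularBoosts.lean (+ closes),
QCDOS.lean, QCDTimeReflection.lean, OSData.lean; inherited and not repeated: the card's
arXiv/galaxy-intelligent/frontier searches and the novelty audit's crossref (12) + galaxy (0)
queries; kit j001443 run on the typed operator.
Nearest prior art found: MontvayMunster1994 §4.2.3 (4.99)–(4.111) (axis site-RP of r = 1 Wilson
fermions, |K| < 1/6 — the proof t  [refs: 10.1103/physrevd.82.114503, 10.1103/physrevd.66.077503, 10.1016/0550-3213(84, 2309.04314, 2003.05781, 1008.4857, doi:10.1103/physrevd.82.114503, doi:10.1103/physrevd.66.077503, doi:10.1016/0550-3213, MontvayMunster1994, Sint2011]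

Barriers (technique_class: rp-wall, multi-mirror-rp, modular-localization): - technique_class: rp-wall, multi-mirror-rp, modular-localization, defect-universality
- Literature.Barriers.QuantumFields.RegularisationDichotomy: evaded — positivity is exact on the
lattice for an auxiliary translation-NON-invariant regularisation (the wall) sharing the honest
scheme's limit, and E1 is recovered in that limit from positivity it inherits (16 mirrors) with no
Euclid-invariant comparison cutoff and no uniqueness device; NoDiagonalFermionRP
(translation-invariant ultralocal Θ, the barrier's fermionic sharpening) does not apply to the wall
theory.
- Literature.Barriers.QuantumFields.ImprovedActionPositivityViolation: respected — nothing non-RP is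
asked to be RP; the bulk action is Wilson's r = 1 exactly as the Statement hard-codes it, the wall
modification is ultralocal, keeps γ₅-hermiticity and the hermitian part (doublers stay lifted), and
improvement is neither used nor needed.
- Literature.Barriers.QuantumFields.NielsenNinomiya: untouched — no chirality is claimed; bulk r = 1
Wilson, wall ultralocal.
- Literature.Barriers.QuantumFields.AokiPhaseDichotomy: engaged only through WallDiagonalRP's
failure mode (wall-localised criticality near κ_c(β)); every item carries the Statement's positive
renormalised masses / uniform lattice gap, which keeps the scheme out of the Aoki fingers
(SharpeSingleton1998).
- Literature.Barriers.QuantumFields.UVStabilityNonUniqueness: orthogonal for the engine (16-mirror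
RP, hypercubic invariance and the cone are closed conditions

History (route lifecycle, newest last):
- 2026-08-15T16:16:22Z · rev 3: restated WallDiagonalRP (stmt-QuantumFields-9908) — repair (same session as the rev-2 cone repair): RESTATE WallDiagonalRP (stmt-QuantumFields-9908, crux r2) 1:1 over the package W, + new deciding theorem. Why: a (planner-rrepair-QuantumFields-TransparentRPWal-a176ec11-g2-0)
- 2026-08-16T23:11:39Z · rev 4: restated QCDHypercubicLimit (stmt-QuantumFields-9912) — route-repair (statement-revised p117723, `def QCDOf` gained `reg.IsChiralAtZero`): RESTATE QCDHypercubicLimit (stmt-QuantumFields-9912, crux r6, wanted only her (planner-rrepair-QuantumFields-TransparentRPWal-6c84d64a-0)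
- 2026-08-17T08:06:23Z · rev 14: dropped PlanarToEuclidean — crux-strategist (cstrat-17272), BC2 redirect of QCDHypercubicLimit, step 2/3: free one top-level slot under the 15-item cap by UNLISTING the closed, shared, lan (planner-cstrat-stmt-QuantumFields-17272-r1-0)
- 2026-08-17T08:11:19Z · rev 16: restated Assembly (stmt-QuantumFields-9915) — crux-strategist (cstrat-17272), housekeeping after the BC2 redirect: the Assembly item (stmt-QuantumFields-9915) referenced the unlisted decl PlanarToEuclidean (planner-cstrat-stmt-QuantumFields-17272-r1-0)
- 2026-08-17T09:48:51Z · rev 19: dropped FreeWallRPCertificate, LabelledAxisFrames, GaugeWallRP — crux-strategist (cstrat-10466) BC2 redirect of WallDiagonalRP, step 2a/3: free three top-level slots under the 15-item cap before adding the pieces, by UNLISTIN (planner-cstrat-stmt-QuantumFields-10466-r1-0)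
- 2026-08-17T09:57:41Z · rev 21: restated Assembly (stmt-QuantumFields-18094) — crux-strategist (cstrat-10466) BC2 redirect of WallDiagonalRP, step 3/3: housekeeping — restate the optional Assembly item (stmt-QuantumFields-18094) to the typ (planner-cstrat-stmt-QuantumFields-10466-r1-0)
- 2026-08-24T17:52:52Z · DORMANT — reconciler: no traction for 6.9 d (last activity item-evidence-added at 2026-08-17T18:31:48Z); parked, not closed — `ledger route dormant route-QuantumFields-Tr (operator:999:545617)
- 2026-08-28T21:23:35Z · REACTIVATED — reconciler: reactivated — activity statement-closed at 2026-08-28T18:48:25Z after parking at 2026-08-24T17:52:52Z (operator:999:2990615)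

sub-problem: QCD · status: open · opened planner-plancard-QuantumFields-QCD-transparen-fcbf87f8-0 2026-08-15T14:52:18Z · rev 22 · ledger route-QuantumFields-TransparentRPWall
GENERATED by the gate from the ledger (D-0016/17). Provers cite these decls: `theorem foo : Summit.QuantumFields.QCD.Theses.TransparentRPWall.<Decl> := …` in Summits/QuantumFields/QCD/Theorems/<Name>.lean.
-/

namespace Summit.QuantumFields.QCD.Theses.TransparentRPWall

open scoped BigOperators Topology Manifold Classical MeasureTheory ProbabilityTheory Matrix InnerProductSpace ComplexConjugate ContinuousMap
open Filter Set Function TopologicalSpace MeasureTheory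

attribute [summit_statement] _root_.QCD

open Literature.MathematicalPhysics.QuantumFieldTheory

/-! Retired items kept as plain definitions (history; not obligations of this route): landed proofs / closed glue still name them. -/

-- earlier PlanarToEuclidean (stmt-QuantumFields-9669, dropped): proved by Summit.QuantumFields.YangMills.Theorems.PlanarToEuclidean_proof @ 26cdd46311db [kept as a comment: unresolved Literature.MathematicalPhysics.AQFT, Literature.MathematicalPhysics.QuantumFieldTheory, Literature.MathematicalPhysics.QuantumLattice] — open Literature.MathematicalPhysics.QuantumLattice Literature.MathematicalPhysics.AQFT Literature.MathematicalPhysics.QuantumFieldTheory in let E := EuclideanSpace ℝ (Fin 4); ∀ (ι : Type) (S : LabelledSchwingerFamily ι (E)), (∀ (n : ℕ) (k : Fin n → ι) (R : E ≃ₗᵢ[ℝ] E), LinearMap.det (R.toLinearEquiv : E →ₗ[ℝ] E) = 1 → (∀ i : Fin 4, ∃ j : Fin 4, R (EuclideanSpace.single i 1) = EuclideanSpace.single j 1 ∨ R (EuclideanSpace.single i 1) = -EuclideanSpace.single j 1) → ∀ F : SchwartzMap (Fin n → E) ℂ, IsOffDiagonal F → S n k (linActMulti R F) = S n k F) → (∀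 (R : E ≃ₗᵢ[ℝ] E), LinearMap.det (R.toLinearEquiv : E →ₗ[ℝ] E) = 1 → R (EuclideanSpace.single 2 1) = EuclideanSpace.single 2 1 → R (EuclideanSpace.single 3 1) = EuclideanSpace.single 3 1 → ∀ (n : ℕ) (k : Fin n → ι) (F : SchwartzMap (Fin n → E) ℂ), IsOffDiagonal F → S n k (linActMulti R F) = S n k F) → ∀ (n : ℕ) (k : Fin n → ι) (R : E ≃ₗᵢ[ℝ] E), LinearMap.det (R.toLinearEquiv : E →ₗ[ℝ] E) = 1 → ∀ F : SchwartzMap (Fin n → E) ℂ, IsOffDiagonal F → S n k (linActMulti R F) = S n k F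

/-- item stmt-QuantumFields-17994 · crux · rank 2 · open · by planner
why it might fail: A wall-critical (layer-Aoki) or bound-state-carrying wall is opaque: the induced marginal wall mass ψ̄ψ|_W must stay O(g₀²) untuned; and torus-vs-45°-cover insensitivity along an ARBITRARY gapped scheme is existence-level (YM DiagonalMirrorRPR: 19 leads, no W-derivation).
sources: Symanzik1983, LuscherEtAl1992, Sint2011, SharpeSingleton1998, Aoki1984WilsonPhase, Luscher1977
[crux] X_T OF THE BC2 REDIRECT OF WallDiagonalRP — THE BET (card K2; the recorded why-might-fail of
the parent now isolated in ONE item): WALL TRANSPARENCY. For every N_f, scheme sch and labelled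
family S carrying the package W (verbatim: E0, E0', E2, E3, E4, translations, proper signed
permutations on ⁰𝒮; two-loop AF, physical branch, convergence of the honest `qcdLatticeSchwinger` to
S on off-diagonal real tensors; continuum + uniform lattice gap): for every n ≠ 0, species string σ
and COMPACTLY SUPPORTED real test functions fᵢ with PAIRWISE DISJOINT supports, THE WALL
APPROXIMANTS CONVERGE TO THE SAME S: stated in NAMED-APPROXIMANT form ∃ Λ, Λ = (k n σ f ↦
Λʷ_k(n,σ,f)) ∧ (Λ ≡ 1 in degree 0) ∧ (∀ real tensor F of the fᵢ, Λ k n σ f → 𝔖ₙ^σ(F)), Λʷ the wall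
functional on the 45° cover written inline (verbatim the one of CoverWallRP) — the equation pins the
witness, so the item is equivalent to its plain form `wall − honest → 0 on compact disjoint real
tensors` given W's convergence clause (proved in the skeleton), and `closes` threads the wall
functional by a bound name (no higher-order unification). This is exactly the hypothesis currency of
DiagonalRPClosure. Two physically distin -/
@[route_item "route-QuantumFields-TransparentRPWall", crux]
def WallTransparency : Prop :=
  open Literature.MathematicalPhysics.QuantumLattice Literature.MathematicalPhysics.AQFT Literature.MathematicalPhysics.QuantumFieldTheory Literature.Probability.LatticeModels in let E := EuclideanSpace ℝ (Fin 4); let SU3 := ↥(Matrix.specialUnitaryGroup (Fin 3) ℂ); let γn : Matrix (Fin 4) (Fin 4) ℂ := (((Real.sqrt 2)⁻¹ : ℝ) : ℂ) • (euclideanGamma 0 - euclideanGamma 1); let Wfun : (Nf : ℕ) → QCDScheme Nf → ℕ → (n : ℕ) → (Fin n → QCDField Nf) → (Fin n → SchwartzMap E ℝ) → ℂ := fun Nf sch k n σ f => (let T := TiltedTorus.Site (sch.side k); let C := TiltedTorus.Config (sch.side k) SU3; let ρ := fundamentalRep (Fin 3); let V := Fin Nf × (T × Fin 3 × Fin 4);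 let I := Fin (Fintype.card V); let e : V ≃ I := Fintype.equivFin V; let A := GrassmannAlgebra ℂ (I ⊕ₗ I); let wall : T → Prop := fun x => x.1 = 0 ∨ x.1 = ((sch.side k : ℕ) : ZMod (2 * sch.side k)); let Γ : Fin 4 → T → T → Matrix (Fin 4) (Fin 4) ℂ := fun μ x y => if (μ = 0 ∨ μ = 1) ∧ (wall x ∨ wall y) then (if μ = 0 then γn else -γn) else euclideanGamma μ; let D : C → Matrix I I ℂ := fun U => Matrix.reindex e e (Matrix.of fun v w => if v.1 = w.1 then ((if v.2 = w.2 then ((sch.mq v.1 k + 4 : ℝ) : ℂ) else 0) - (1 / 2 : ℂ) * ∑ μ : Fin 4, ((if w.2.1 = v.2.1 + TiltedTorus.step μ then (1 - Γ μ v.2.1 w.2.1) v.2.2.2 w.2.2.2 * ρ (U (v.2.1, μ)) v.2.2.1 w.2.2.1 else 0) + (if v.2.1 = w.2.1 + TiltedTorus.step μ then (1 + Γ μ v.2.1 w.2.1) v.2.2.2 w.2.2.2 * ρ ((U (w.2.1, μ))⁻¹) v.2.2.1 w.2.2.1 else 0))) else 0); let boltz : C → A := fun U => grassmannExp (quadratic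 ℂ (-D U)); let P : Fin Nf → Fin Nf → T → A := fun fl g x => ∑ a : Fin 3, ∑ α : Fin 4, ∑ β : Fin 4, (Complex.I * gammaFive α β) • (psiBar ℂ (e (fl, (x, a, α))) * psi ℂ (e (g, (x, a, β)))); let ins : C → QCDField Nf → Site 4 → A := fun U s x => let y := TiltedTorus.proj (sch.side k) x; match s with | .glue => algebraMap ℂ A ((actionDensity ρ (configShift (-x) (TiltedTorus.lift (sch.side k) U)) : ℝ) : ℂ) | .pseudoRe fl g => (1 / 2 : ℂ) • (P fl g y + P g fl y) | .pseudoIm fl g => (-Complex.I / 2) • (P fl g y - P g fl y); let sm : C → QCDField Nf → SchwartzMap E ℝ → A := fun U s h => ∑ x ∈ box 4 (sch.L k), ((sch.z s k * sch.a k ^ 4 * h (sch.a k • siteToE x) : ℝ) : ℂ) • (ins U s x - algebraMap ℂ A ((sch.shift s k : ℝ) : ℂ)); let wt : C → ℂ := fun U => ((TiltedTorus.weight ρ (sch.β k) U : ℝ) : ℂ); let ber := GrassmannAlgebra.berezin ℂ (I ⊕ₗ I); let ν := (TiltedTorus.haar (sch.side k) : Measure C); if n = 0 then (1 : ℂ)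 else (∫ U, ber ((List.ofFn fun i => sm U (σ i) (f i)).prod * boltz U) * wt U ∂ν) / (∫ U, ber (boltz U) * wt U ∂ν)); ∀ (Nf : ℕ) (sch : QCDScheme Nf) (S : LabelledSchwingerFamily (QCDField Nf) E), (S.IsNormalized ∧ S.IsHermitian ∧ S.HasLinearGrowth ∧ S.IsReflectionPositive ∧ S.IsSymmetric ∧ S.HasClusterProperty) → (sch.HasAsymptoticScaling ∧ (∀ fl : Fin Nf, ∀ᶠ k in Filter.atTop, -1 < sch.mq fl k) ∧ (∀ (n : ℕ), n ≠ 0 → ∀ (σ : Fin n → QCDField Nf) (f : Fin n → SchwartzMap E ℝ) (F : SchwartzMap (Fin n → E) ℂ), IsTensorOf F (fun i => ofRealTest (f i)) → IsOffDiagonal F → Filter.Tendsto (fun k : ℕ => qcdLatticeSchwinger sch k n σ f) Filter.atTop (nhds (S n σ F)))) → (∃ Δ : ℝ, 0 < Δ ∧ S.HasMassGap Δ ∧ sch.HasLatticeMassGap Δ) → ∃ Λ : (ℕ → (n : ℕ) → (Fin n → QCDField Nf) → (Fin n → SchwartzMap E ℝ) → ℂ), Λ = (fun k n σ f => Wfun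 Nf sch k n σ f) ∧ (∀ (k : ℕ) (σ : Fin 0 → QCDField Nf) (f : Fin 0 → SchwartzMap E ℝ), Λ k 0 σ f = 1) ∧ (∀ (n : ℕ), n ≠ 0 → ∀ (σ : Fin n → QCDField Nf) (f : Fin n → SchwartzMap E ℝ), (∀ i, HasCompactSupport (f i : E → ℝ)) → (∀ i j, i ≠ j → Disjoint (tsupport (f i : E → ℝ)) (tsupport (f j : E → ℝ))) → ∀ F : SchwartzMap (Fin n → E) ℂ, IsTensorOf F (fun i => ofRealTest (f i)) → Filter.Tendsto (fun k : ℕ => Λ k n σ f) Filter.atTop (nhds (S n σ F)))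

/-- item stmt-QuantumFields-17995 · crux · rank 3 · open · by planner
why it might fail: The oblique factorisation with links inside B_σ on a volume with TWO wall layers is unrun beyond one-particle numerics (kit j001443/j001345); a sign slip in the γ_n lift / Berezin orientation, or ‖1−B_σ‖ → 1 as κ → 1/4, breaks exactness; N_f ≥ 17 junk inherited (R1).
sources: MontvayMunster1994, OsterwalderSeiler1978, Luscher1977, FrohlichIsraelLiebSimon1978, MenottiPelissetto1987, kit:j001443
[crux] X_R OF THE BC2 REDIRECT OF WallDiagonalRP (crux-strategist 2026-08-17, cstrat-10466): EXACT
SWAP REFLECTION POSITIVITY OF WALL-MODIFIED LATTICE QCD ON THE FILS 45° COVER, read on smeared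
species strings. For every N_f and every scheme sch with two-loop asymptotic scaling, bare Wilson
masses eventually on the physical branch and some uniform lattice gap (the scheme clauses of W,
verbatim): for every finite family of COMPACTLY SUPPORTED real test functions in the open half-space
{x₁ < x₀} (arities deg j, label strings lab j, coefficients c j ∈ ℂ), EVENTUALLY IN k the swap Gram
sum Σᵢⱼ c̄ᵢ cⱼ Λ k (deg i + deg j)^{rev lab i ++ lab j}((fᵢ∘swap reversed) ++ fⱼ) is real ≥ 0 for
every Λ EQUAL to the wall functional (named-approximant form ∀ Λ, Λ = (k n σ f ↦ Λʷ_k(n,σ,f)) → …,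
equivalent to the plain form), where Λʷ_k is THE WALL FUNCTIONAL written inline: Wilson's SU(3)
plaquette weight `TiltedTorus.weight` on the 45° cover T̃_{2L_k+1} = ℤ_{2N}×ℤ_N³ (chart u = x₀−x₁;
Literature TiltedTorusLatticeSchwinger, the volume on which Wilson's measure IS swap-RP), N_f
Wilson–Dirac quarks (r = 1, masses m_f(k)) whose hops in directions 0,1 touching a wall layer u ∈
{0, N} carry γ₀ ↦ +γ_n, γ₁ -/
@[route_item "route-QuantumFields-TransparentRPWall", crux (experiment := "instrument: kit jobs cited as sources kit:j001443, kit:j001345") (source := "ledger wanted_by.sources on stmt-QuantumFields-17995, 2026-09-01")]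
def CoverWallRP : Prop :=
  open Literature.MathematicalPhysics.QuantumLattice Literature.MathematicalPhysics.AQFT Literature.MathematicalPhysics.QuantumFieldTheory Literature.Probability.LatticeModels in let E := EuclideanSpace ℝ (Fin 4); let SU3 := ↥(Matrix.specialUnitaryGroup (Fin 3) ℂ); let γn : Matrix (Fin 4) (Fin 4) ℂ := (((Real.sqrt 2)⁻¹ : ℝ) : ℂ) • (euclideanGamma 0 - euclideanGamma 1); let Wfun : (Nf : ℕ) → QCDScheme Nf → ℕ → (n : ℕ) → (Fin n → QCDField Nf) → (Fin n → SchwartzMap E ℝ) → ℂ := fun Nf sch k n σ f => (let T := TiltedTorus.Site (sch.side k); let C := TiltedTorus.Config (sch.side k) SU3; let ρ := fundamentalRep (Fin 3); let V := Fin Nf × (T × Fin 3 × Fin 4); let I := Fin (Fintype.card V); let e : V ≃ I := Fintype.equivFin V; let A := GrassmannAlgebra ℂ (I ⊕ₗ I); let wall : T → Prop := fun x => x.1 = 0 ∨ x.1 = ((sch.side k : ℕ) : ZMod (2 * sch.side k)); let Γ : Fin 4 → T → T → Matrix (Fin 4) (Fin 4) ℂ := fun μ x y => if (μ = 0 ∨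 μ = 1) ∧ (wall x ∨ wall y) then (if μ = 0 then γn else -γn) else euclideanGamma μ; let D : C → Matrix I I ℂ := fun U => Matrix.reindex e e (Matrix.of fun v w => if v.1 = w.1 then ((if v.2 = w.2 then ((sch.mq v.1 k + 4 : ℝ) : ℂ) else 0) - (1 / 2 : ℂ) * ∑ μ : Fin 4, ((if w.2.1 = v.2.1 + TiltedTorus.step μ then (1 - Γ μ v.2.1 w.2.1) v.2.2.2 w.2.2.2 * ρ (U (v.2.1, μ)) v.2.2.1 w.2.2.1 else 0) + (if v.2.1 = w.2.1 + TiltedTorus.step μ then (1 + Γ μ v.2.1 w.2.1) v.2.2.2 w.2.2.2 * ρ ((U (w.2.1, μ))⁻¹) v.2.2.1 w.2.2.1 else 0))) else 0); let boltz : C → A := fun U => grassmannExp (quadratic ℂ (-D U)); let P : Fin Nf → Fin Nf → T → A := fun fl g x => ∑ a : Fin 3, ∑ α : Fin 4, ∑ β : Fin 4, (Complex.I * gammaFive α β) • (psiBar ℂ (e (fl, (x, a, α))) * psi ℂ (e (g, (x, a, β)))); let ins : C → QCDField Nf → Site 4 → A := fun U s x => let y := TiltedTorus.proj (sch.side k)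 x; match s with | .glue => algebraMap ℂ A ((actionDensity ρ (configShift (-x) (TiltedTorus.lift (sch.side k) U)) : ℝ) : ℂ) | .pseudoRe fl g => (1 / 2 : ℂ) • (P fl g y + P g fl y) | .pseudoIm fl g => (-Complex.I / 2) • (P fl g y - P g fl y); let sm : C → QCDField Nf → SchwartzMap E ℝ → A := fun U s h => ∑ x ∈ box 4 (sch.L k), ((sch.z s k * sch.a k ^ 4 * h (sch.a k • siteToE x) : ℝ) : ℂ) • (ins U s x - algebraMap ℂ A ((sch.shift s k : ℝ) : ℂ)); let wt : C → ℂ := fun U => ((TiltedTorus.weight ρ (sch.β k) U : ℝ) : ℂ); let ber := GrassmannAlgebra.berezin ℂ (I ⊕ₗ I); let ν := (TiltedTorus.haar (sch.side k) : Measure C); if n = 0 then (1 : ℂ) else (∫ U, ber ((List.ofFn fun i => sm U (σ i) (f i)).prod * boltz U) * wt U ∂ν) / (∫ U, ber (boltz U) * wt U ∂ν)); let swapT : SchwartzMap E ℝ → SchwartzMap E ℝ := fun h => SchwartzMap.compCLMOfContinuousLinearEquiv ℝ (LinearIsometryEquiv.piLpCongrLeft 2 ℝ ℝ (Equiv.swap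 (0 : Fin 4) 1)).toContinuousLinearEquiv h; ∀ (Nf : ℕ) (sch : QCDScheme Nf), sch.HasAsymptoticScaling → (∀ fl : Fin Nf, ∀ᶠ k in Filter.atTop, -1 < sch.mq fl k) → (∃ Δ : ℝ, 0 < Δ ∧ sch.HasLatticeMassGap Δ) → ∀ Λ : (ℕ → (n : ℕ) → (Fin n → QCDField Nf) → (Fin n → SchwartzMap E ℝ) → ℂ), Λ = (fun k n σ f => Wfun Nf sch k n σ f) → ∀ (N : ℕ) (c : Fin N → ℂ) (deg : Fin N → ℕ) (lab : (j : Fin N) → Fin (deg j) → QCDField Nf) (f : (j : Fin N) → Fin (deg j) → SchwartzMap E ℝ), (∀ j l, HasCompactSupport (f j l : E → ℝ) ∧ tsupport (f j l : E → ℝ) ⊆ {y : E | y 1 < y 0}) → ∀ᶠ k in Filter.atTop, let z := ∑ i, ∑ j, starRingEnd ℂ (c i) * c j * Λ k (deg i + deg j) (Fin.append (lab i ∘ Fin.rev) (lab j)) (Fin.append (fun l => swapT (f i (Fin.rev l))) (f j)); 0 ≤ z.re ∧ z.im = 0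

/-- item stmt-QuantumFields-18042 · crux · rank 3 · open · by planner
why it might fail: (ii) at levels a ≥ 2 has no engine (sibling TRIAGE r1-2): W bounds neither the z_s(k)a_k⁴-renormalised moments nor the crossover; 'dimension < 5' must survive Wilson-fermion mixing; (i) for n ≥ 3 is UV temperedness of composite moment densities — part of existence.
sources: LuscherWeisz1985, Symanzik1983, OsterwalderSchrader1975, GlimmJaffe1987, MontvayMunster1994, JaffeWitten2000
[crux] WHAT THE LATTICE TIE MUST SUPPLY TO THE SIEVE — USES THE TIE (piece 1 of the crux-strategist
split of QCDBoostCovariance, 2026-08-17; the labelled twin of the TWO places where the lattice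
enters the sibling line YangMills/Cruxes/CurvatureBoostCovariance/Lines/boosts_inherit_mirrors.lean:
`stub_tieRegularity` (Step 0) and `stub_levelGrowthLow/High` (the Transfer C⁺ = ∀a G_a)). For every
N_f, every lattice-QCD scheme sch and every labelled Schwinger family S over QCDField N_f carrying
the package W of QCDBoostCovariance (E0, E0', E2, E3, E4, translation + proper-hypercubic invariance
on ⁰𝒮; asymptotic scaling, physical branch, convergence of honest lattice QCD along sch to S;
continuum + uniform lattice gap), the eight planar frames and the labelled planar cone: (i) STEP 0 —
EVERY species string is n-POINT REGULAR: for all n and all label strings k there is a function W_n^k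
on (ℝ⁴)ⁿ with W_n^k·F ∈ L¹ and 𝔖ₙᵏ(F) = ∫ W_n^k·F for every F ∈ ⁰𝒮ₙ (the function residual
protecting the model-blind sieve, piece 2, from the junk families — YangMills
NPointIsotropy.Negative.not_nPointRegular_junk); AND (ii) LEVEL GROWTH — at every OS level a: IF
every string of degree ≤ 2a−2 is already i -/
@[route_item "route-QuantumFields-TransparentRPWall", crux]
def QCDSieveInputs : Prop :=
  open Literature.MathematicalPhysics.QuantumLattice Literature.MathematicalPhysics.AQFT Literature.MathematicalPhysics.QuantumFieldTheory in let E := EuclideanSpace ℝ (Fin 4); let W := fun (Nf : ℕ) (sch : QCDScheme Nf) (S : LabelledSchwingerFamily (QCDField Nf) E) => ((S.IsNormalized ∧ S.IsHermitian ∧ S.HasLinearGrowth ∧ S.IsReflectionPositive ∧ S.IsSymmetric ∧ S.HasClusterProperty ∧ (∀ (n : ℕ) (k : Fin n → QCDField Nf) (a : E) (F : SchwartzMap (Fin n → E) ℂ), IsOffDiagonal F → S n k (translateMulti a F) = S n k F) ∧ (∀ (n : ℕ) (k : Fin n → QCDField Nf) (R : E ≃ₗᵢ[ℝ] E), LinearMap.det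 (R.toLinearEquiv : E →ₗ[ℝ] E) = 1 → (∀ i : Fin 4, ∃ j : Fin 4, R (EuclideanSpace.single i 1) = EuclideanSpace.single j 1 ∨ R (EuclideanSpace.single i 1) = -EuclideanSpace.single j 1) → ∀ F : SchwartzMap (Fin n → E) ℂ, IsOffDiagonal F → S n k (linActMulti R F) = S n k F)) ∧ (sch.HasAsymptoticScaling ∧ (∀ fl : Fin Nf, ∀ᶠ k in Filter.atTop, -1 < sch.mq fl k) ∧ (∀ (n : ℕ), n ≠ 0 → ∀ (σ : Fin n → QCDField Nf) (f : Fin n → SchwartzMap E ℝ) (F : SchwartzMap (Fin n → E) ℂ), IsTensorOf F (fun i => ofRealTest (f i)) → IsOffDiagonal F → Filter.Tendsto (fun k : ℕ => qcdLatticeSchwinger sch k n σ f) Filter.atTop (nhds (S n σ F)))) ∧ (∃ Δ : ℝ, 0 < Δ ∧ S.HasMassGap Δ ∧ sch.HasLatticeMassGap Δ)); ∀ (Nf : ℕ) (sch : QCDScheme Nf) (S : LabelledSchwingerFamily (QCDField Nf) E), W Nf sch S → (∀ (R : E ≃ₗᵢ[ℝ] E) (a b : ℝ), a ^ 2 + b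 ^ 2 = 1 → (a = 0 ∨ b = 0 ∨ a ^ 2 = b ^ 2) → R (EuclideanSpace.single 0 1) = a • EuclideanSpace.single 0 1 + b • EuclideanSpace.single 1 1 → LabelledSchwingerFamily.IsReflectionPositive (fun n (k : Fin n → QCDField Nf) => (S n k).comp (linActMulti R))) → (∀ (n m : ℕ) (k : Fin n → QCDField Nf) (k' : Fin m → QCDField Nf) (F : SchwartzMap (Fin n → E) ℂ) (G : SchwartzMap (Fin m → E) ℂ), IsTimeOrdered F → IsTimeOrdered G → ∃ Φ : ℂ × ℂ → ℂ, DifferentiableOn ℂ Φ {w : ℂ × ℂ | |w.2.im| < w.1.re} ∧ (∀ (t b : ℝ), 0 < t → ∀ H : SchwartzMap (Fin (n + m) → E) ℂ, IsAppendTensorOf H (osAdjoint F) (translateMulti (t • EuclideanSpace.single 0 1 + b • EuclideanSpace.single 1 1) G) → Φ ((t : ℂ), (b : ℂ)) = S (n + m) (Fin.append (k ∘ Fin.rev) k') H) ∧ (∀ w ∈ {w : ℂ × ℂ | |w.2.im| < w.1.re}, ∀ (HF : SchwartzMap (Fin (n + n) → E) ℂ) (HG : SchwartzMap (Fin (m +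 m) → E) ℂ), IsAppendTensorOf HF (osAdjoint F) F → IsAppendTensorOf HG (osAdjoint G) G → ‖Φ w‖ ^ 2 ≤ ‖S (n + n) (Fin.append (k ∘ Fin.rev) k) HF‖ * ‖S (m + m) (Fin.append (k' ∘ Fin.rev) k') HG‖)) → (∀ (n : ℕ) (k : Fin n → QCDField Nf), ∃ Wf : (Fin n → E) → ℂ, ∀ F : SchwartzMap (Fin n → E) ℂ, IsOffDiagonal F → MeasureTheory.Integrable (fun x : Fin n → E => Wf x * F x) ∧ S n k F = ∫ x : Fin n → E, Wf x * F x) ∧ (∀ a : ℕ, (∀ N : ℕ, N + 2 ≤ 2 * a → ∀ R : E ≃ₗᵢ[ℝ] E, LinearMap.det (R.toLinearEquiv : E →ₗ[ℝ] E) = 1 → R (EuclideanSpace.single 2 1) = EuclideanSpace.single 2 1 → R (EuclideanSpace.single 3 1) = EuclideanSpace.single 3 1 → ∀ (k : Fin N → QCDField Nf) (F : SchwartzMap (Fin N → E) ℂ), IsOffDiagonal F → S N k (linActMulti R F) = S N k F) → ∀ (k : Fin a → QCDField Nf) (F : SchwartzMap (Fin a → E) ℂ), IsTimeOrdered F → HasCompactSupport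 (F : (Fin a → E) → ℂ) → ∀ H : SchwartzMap (Fin (a + a) → E) ℂ, IsAppendTensorOf H (osAdjoint F) F → ∀ (K : ℕ) (p : ℤ → ℂ), (∀ θ : ℝ, S (a + a) (Fin.append (k ∘ Fin.rev) k) (linActMulti (planeRot (0 : Fin 3) θ) H) = ∑ j ∈ Finset.Icc (-(K : ℤ)) K, p j * Complex.exp (4 * (j : ℂ) * (θ : ℂ) * Complex.I)) → ∀ j ∈ Finset.Icc (-(K : ℤ)) K, 2 ≤ |j| → p j = 0)

/-- item stmt-QuantumFields-18043 · crux · rank 4 · open · by planner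
why it might fail: Multi-slot OS-II continuation WITHOUT E1 along complex-rotation orbits (boost vectors of exponential type, uniform in the test function) is unbuilt beyond degree 1 even for one species; a labelled 8-frame family whose boosted vectors are not of exponential type in the rapidity breaks the band limit.
sources: OsterwalderSchrader1973, OsterwalderSchrader1975, GlimmJaffe1987, Borchers1992, GaierYngvason2000
[crux] THE MODEL-BLIND SIEVE, ANY LABEL TYPE (piece 2 of the split; labelled twin of
`sieve_of_stubs` of the sibling line, whose one-species stubs are landed or registered:
OrbitBandlimit(Local), RayPositivity(Local), ParitySieve, DoubledToInvariant, TensorDensity,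
GramVecOnStrip, OperatorConeFamily). For a labelled Schwinger family S over ANY label type ι on ℝ⁴
with E0, E0', E2, E3, E4, translation and proper-hypercubic invariance on ⁰𝒮, reflection positivity
in pull-back form for the eight planar frames and the labelled planar cone: IF every string is
n-point regular AND the level growth holds at every level (the two conjuncts of piece 1,
QCDSieveInputs) THEN every string is invariant on ⁰𝒮 under every determinant-one isometry fixing e₂,
e₃ — verbatim the conclusion of QCDBoostCovariance. Mechanism (boosts inherit the mirrors): with the
cone, a rotation by an imaginary angle iχ is a boost, H_χ = cosh χ·H + sinh χ·P₁ ≥ 0, so the doubled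
orbit function θ ↦ 𝔖(R_θ·(ΘF*⊗G)) continues to an entire π/2-periodic function of exponential type
(OS II multi-slot continuation without E1 + the function residual), i.e. a trigonometric polynomial
Σ c_j e^{4ijθ} (Paley–Wiener, landed), whose Laur -/
@[route_item "route-QuantumFields-TransparentRPWall", crux]
def LabelledBoostSieve : Prop :=
  open Literature.MathematicalPhysics.QuantumLattice Literature.MathematicalPhysics.AQFT Literature.MathematicalPhysics.QuantumFieldTheory in let E := EuclideanSpace ℝ (Fin 4); ∀ (ι : Type) (S : LabelledSchwingerFamily ι E), S.IsNormalized → S.IsHermitian → S.HasLinearGrowth → S.IsReflectionPositive → S.IsSymmetric → S.HasClusterProperty → (∀ (n : ℕ) (k : Fin n → ι) (a : E) (F : SchwartzMap (Fin n → E) ℂ), IsOffDiagonal F → S n k (translateMulti a F) = S n k F) → (∀ (n : ℕ) (k : Fin n → ι) (R : E ≃ₗᵢ[ℝ] E), LinearMap.det (R.toLinearEquiv : E →ₗ[ℝ] E) = 1 → (∀ i : Fin 4, ∃ j : Fin 4, R (EuclideanSpace.single i 1) = EuclideanSpace.single j 1 ∨ R (EuclideanSpace.single i 1) = -EuclideanSpace.single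 j 1) → ∀ F : SchwartzMap (Fin n → E) ℂ, IsOffDiagonal F → S n k (linActMulti R F) = S n k F) → (∀ (R : E ≃ₗᵢ[ℝ] E) (a b : ℝ), a ^ 2 + b ^ 2 = 1 → (a = 0 ∨ b = 0 ∨ a ^ 2 = b ^ 2) → R (EuclideanSpace.single 0 1) = a • EuclideanSpace.single 0 1 + b • EuclideanSpace.single 1 1 → LabelledSchwingerFamily.IsReflectionPositive (fun n (k : Fin n → ι) => (S n k).comp (linActMulti R))) → (∀ (n m : ℕ) (k : Fin n → ι) (k' : Fin m → ι) (F : SchwartzMap (Fin n → E) ℂ) (G : SchwartzMap (Fin m → E) ℂ), IsTimeOrdered F → IsTimeOrdered G → ∃ Φ : ℂ × ℂ → ℂ, DifferentiableOn ℂ Φ {w : ℂ × ℂ | |w.2.im| < w.1.re} ∧ (∀ (t b : ℝ), 0 < t → ∀ H : SchwartzMap (Fin (n + m) → E) ℂ, IsAppendTensorOf H (osAdjoint F) (translateMulti (t • EuclideanSpace.single 0 1 + b • EuclideanSpace.single 1 1) G) → Φ ((t : ℂ), (b : ℂ)) = S (n + m) (Fin.append (k ∘ Fin.rev) k') H) ∧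 (∀ w ∈ {w : ℂ × ℂ | |w.2.im| < w.1.re}, ∀ (HF : SchwartzMap (Fin (n + n) → E) ℂ) (HG : SchwartzMap (Fin (m + m) → E) ℂ), IsAppendTensorOf HF (osAdjoint F) F → IsAppendTensorOf HG (osAdjoint G) G → ‖Φ w‖ ^ 2 ≤ ‖S (n + n) (Fin.append (k ∘ Fin.rev) k) HF‖ * ‖S (m + m) (Fin.append (k' ∘ Fin.rev) k') HG‖)) → (∀ (n : ℕ) (k : Fin n → ι), ∃ Wf : (Fin n → E) → ℂ, ∀ F : SchwartzMap (Fin n → E) ℂ, IsOffDiagonal F → MeasureTheory.Integrable (fun x : Fin n → E => Wf x * F x) ∧ S n k F = ∫ x : Fin n → E, Wf x * F x) → (∀ a : ℕ, (∀ N : ℕ, N + 2 ≤ 2 * a → ∀ R : E ≃ₗᵢ[ℝ] E, LinearMap.det (R.toLinearEquiv : E →ₗ[ℝ] E) = 1 → R (EuclideanSpace.single 2 1) = EuclideanSpace.single 2 1 → R (EuclideanSpace.single 3 1) = EuclideanSpace.single 3 1 → ∀ (k : Fin N → ι) (F : SchwartzMap (Fin N → E) ℂ), IsOffDiagonal F →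 S N k (linActMulti R F) = S N k F) → ∀ (k : Fin a → ι) (F : SchwartzMap (Fin a → E) ℂ), IsTimeOrdered F → HasCompactSupport (F : (Fin a → E) → ℂ) → ∀ H : SchwartzMap (Fin (a + a) → E) ℂ, IsAppendTensorOf H (osAdjoint F) F → ∀ (K : ℕ) (p : ℤ → ℂ), (∀ θ : ℝ, S (a + a) (Fin.append (k ∘ Fin.rev) k) (linActMulti (planeRot (0 : Fin 3) θ) H) = ∑ j ∈ Finset.Icc (-(K : ℤ)) K, p j * Complex.exp (4 * (j : ℂ) * (θ : ℂ) * Complex.I)) → ∀ j ∈ Finset.Icc (-(K : ℤ)) K, 2 ≤ |j| → p j = 0) → ∀ (R : E ≃ₗᵢ[ℝ] E), LinearMap.det (R.toLinearEquiv : E →ₗ[ℝ] E) = 1 → R (EuclideanSpace.single 2 1) = EuclideanSpace.single 2 1 → R (EuclideanSpace.single 3 1) = EuclideanSpace.single 3 1 → ∀ (n : ℕ) (k : Fin n → ι) (F : SchwartzMap (Fin n → E) ℂ), IsOffDiagonal F → S n k (linActMulti R F) = S n k F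

/-- item stmt-QuantumFields-18619 · crux · rank 4 · closed · proved by Summit.QuantumFields.QCD.Theorems.transparentRPWall_labelledConeChainDensity_proof (prover) · by planner
why it might fail: Port-only risk (one-species stub_density kernel-checked, E0′/E3 idle): a step that used label-blindness of ι = Unit (identifying Ψ_{F∘σ} with Ψ_F) would need k ↦ k∘σ bookkeeping or E3 in the labelled version; none visible in the landed files, but ~1700 lines to re-thread.
sources: OsterwalderSchraderCMP1975, OsterwalderSchraderCMP1973, GlimmJaffeQP1987
[crux] DENSITY, labelled — piece 2 of the split of LabelledPlanarSpectralCone (crux-strategist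
2026-08-17), the labelled twin of the LANDED one-species `stub_density` = stub_density_of_parts ∘
(stub_oneGap, stub_windowedDensity) (Theorems/MirrorModularBoostsPlanarSpectralCone.lean,
…DensityOfParts, …DensityHelpers, …OneGapKernel/Sector/Bounds/Form, …WindowedDensity of the PROVED
sibling stmt-QuantumFields-9664). In the e₀-frame OS space of ANY labelled Schwinger family on ℝ⁴
with E2 and translation invariance on ⁰𝒮 (h : OSReconstructionNoE1 S; no E0', no E3 — idle in the
one-species proof) the field vectors Ψ_G^k of strict cone chains G (all arities m, ALL label strings
k) span a dense subspace of h.Hilbert. Intended proof = PORT WITH LABELS: (D3) windowed tensor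
products are dense among time-ordered test functions (stub_windowedDensity — landed, label-free:
test functions only); (D0) first-gap absorption; (D1) ONE GAP — for level-separated P ⊗ Q the Gram
kernel K(s,s′) = ⟪Ψ^k_{P⊗Q_s}, Ψ^k_{P⊗Q_{s′}}⟫ is two-slot sector data of opening π/2 (re-centred e₀
mirror), the tree engine continues it, exists_holomorphic_gramVec (m = 1) gives the holomorphic
ℋ-valued stretching on {0 < Re ζ, -/
@[route_item "route-QuantumFields-TransparentRPWall", crux]
def LabelledConeChainDensity : Prop :=
  open Literature.MathematicalPhysics.QuantumLattice Literature.MathematicalPhysics.AQFT Literature.MathematicalPhysics.QuantumFieldTheory in let E := EuclideanSpace ℝ (Fin 4); ∀ (ι : Type) (S : LabelledSchwingerFamily ι E) (h : OSReconstructionNoE1 S), Dense ((Submodule.span ℂ {ψ : h.Hilbert | ∃ (m : ℕ) (k : Fin m → ι) (G : SchwartzMap (Fin m → E) ℂ) (hG : IsTimeOrdered G), tsupport (G : (Fin m → E) → ℂ) ⊆ {x | (∀ i, |x i 1| < x i 0) ∧ ∀ i j, i < j → |x j 1 - x i 1| < x j 0 - x i 0} ∧ ψ = h.fieldVec m k G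 hG} : Submodule ℂ h.Hilbert) : Set h.Hilbert)

-- `LabelledConeChainDensity` holds: proved by `Summit.QuantumFields.QCD.Theorems.transparentRPWall_labelledConeChainDensity_proof` (its module imports this route file, so no `_holds` link can be stated here).

/-- item stmt-QuantumFields-18618 · crux · rank 5 · closed · proved by Summit.QuantumFields.QCD.Theorems.transparentRPWall_labelledConeDiscSections_proof (prover) · by planner
why it might fail: Port-only risk (one-species stub_discSections is kernel-checked; frames/slots/engine/Thales are per vector Ψ_G^k): a helper whose STATEMENT hard-codes Unit labels (ConeChainFrames packages OSReconstructionNoE1 (S∘R±).toLabelled) must be re-proved with label strings, not instantiated — ~800 lines.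
sources: OsterwalderSchraderCMP1975, OsterwalderSchraderCMP1973, GlimmJaffeQP1987
[crux] FRONT END, labelled — piece 1 of the split of LabelledPlanarSpectralCone (crux-strategist
2026-08-17), the labelled twin of the LANDED one-species `stub_discSections`
(Theorems/MirrorModularBoostsPlanarSpectralConeFrontEnd.lean of the PROVED sibling
MirrorModularBoosts.PlanarSpectralCone, stmt-QuantumFields-9664). For a labelled Schwinger family S
over ANY label type ι on ℝ⁴, translation invariant on ⁰𝒮 and reflection positive in pull-back form
for the eight frames of the (x₀,x₁)-plane, h its e₀-frame OS reconstruction (OSReconstructionNoE1 S: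
field vectors Ψ_G^k = h.fieldVec, e^{-tH} = h.transfer, U(a⃗) = h.translate) and G a STRICT CONE
CHAIN (m points, supp G ⊂ {|x_i¹| < x_i⁰ ∧ ∀ i<j, |x_j¹ − x_i¹| < x_j⁰ − x_i⁰}) with ANY label
string k : Fin m → ι: there are c ≥ 0 (in fact c = 0) and ONE constant M such that for every t > c
the diagonal matrix element b ↦ ⟪Ψ_G^k, e^{-tH} U(b e₁) Ψ_G^k⟫ is the restriction to (−(t−c), t−c)
of a function holomorphic on the disc of radius t − c bounded by M. Intended proof = PORT WITH
LABELS of FrontEnd/ConeChainFrames/DiscSections: the ±45° frames R± and the pulled-back LABELLED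
reconstructions h± of (n,k) ↦ S n k ∘ linActMulti R± (the tes -/
@[route_item "route-QuantumFields-TransparentRPWall", crux]
def LabelledConeDiscSections : Prop :=
  open Literature.MathematicalPhysics.QuantumLattice Literature.MathematicalPhysics.AQFT Literature.MathematicalPhysics.QuantumFieldTheory in let E := EuclideanSpace ℝ (Fin 4); ∀ (ι : Type) (S : LabelledSchwingerFamily ι E), (∀ (n : ℕ) (k : Fin n → ι) (a : E) (F : SchwartzMap (Fin n → E) ℂ), IsOffDiagonal F → S n k (translateMulti a F) = S n k F) → (∀ (R : E ≃ₗᵢ[ℝ] E) (a b : ℝ), a ^ 2 + b ^ 2 = 1 → (a = 0 ∨ b = 0 ∨ a ^ 2 = b ^ 2) → R (EuclideanSpace.single 0 1) = a • EuclideanSpace.single 0 1 + b • EuclideanSpace.single 1 1 → LabelledSchwingerFamily.IsReflectionPositive (fun n (k : Fin n → ι) => (S n k).comp (linActMulti R))) → ∀ (h : OSReconstructionNoE1 S) (m : ℕ) (k : Fin m → ι) (G : SchwartzMap (Fin m → E) ℂ) (hG : IsTimeOrdered G), tsupport (G : (Fin m → E) → ℂ) ⊆ {x | (∀ i, |x i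 1| < x i 0) ∧ ∀ i j, i < j → |x j 1 - x i 1| < x j 0 - x i 0} → ∃ c M : ℝ, 0 ≤ c ∧ ∀ t : ℝ, c < t → ∃ f : ℂ → ℂ, DifferentiableOn ℂ f (Metric.ball 0 (t - c)) ∧ (∀ z ∈ Metric.ball (0 : ℂ) (t - c), ‖f z‖ ≤ M) ∧ ∀ b : ℝ, |b| < t - c → f b = inner ℂ (h.fieldVec m k G hG) (h.transfer t (h.translate (EuclideanSpace.single 1 b) (h.fieldVec m k G hG)))

-- `LabelledConeDiscSections` holds: proved by `Summit.QuantumFields.QCD.Theorems.transparentRPWall_labelledConeDiscSections_proof` (its module imports this route file, so no `_holds` link can be stated here).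

/-- item stmt-QuantumFields-18092 · crux · rank 6 · open · by planner
why it might fail: Still the constructive core: no UV-stable construction of 4D SU(3) with dynamical Wilson quarks (Balaban: pure YM, small fields), no engine for the volume-uniform lattice gap through the crossover, IsChiralAtZero imports Goldstone gaplessness; full-sequence convergence for ALL m at once.
sources: JaffeWitten2000, OsterwalderSeiler1978, Seiler1982, MontvayMunster1994, Balaban1989LargeFieldII, BalabanOcarrollSchor1989
[crux] THE EXISTENCE HALF of QCDHypercubicLimit (crux-strategist BC2 redirect 2026-08-17, piece 1 of
2; LINE-NEUTRAL — the lattice-package seam every existence route of the sub uses, cf. the registered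
birth skeletons of FourMirrorsWardE1.QCDModuloRotations (stmt-QuantumFields-17271) and
GapBuysCauchyRate.ConvergentOSClosure (stmt-QuantumFields-11525)). For N_f = 2 and N_f = 3: one
mass-independent regularisation reg with leading-log mass scaling (`reg.HasMassScaling`) and chiral
at zero (`reg.IsChiralAtZero`) such that for every tuple of positive renormalised masses there are
species renormalisations z, shift and a labelled Schwinger family S over QCDField N_f which is
normalised (E0), of linear growth (E0'), symmetric (E3), translation invariant and invariant under
the proper signed permutations (W(B₄) ∩ SO(4)) on ⁰𝒮, IS the k → ∞ limit of the honest lattice-QCD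
n-point functions `qcdLatticeSchwinger (reg.scheme m z shift) k` on off-diagonal real tensors
(two-loop asymptotic scaling, bare Wilson masses eventually on the physical branch m_f(k) > −1),
carries a uniform lattice mass gap Δ > 0 (`HasLatticeMassGap`) at the same couplings, and has
non-trivial and non-Gaussian glue and -/
@[route_item "route-QuantumFields-TransparentRPWall", crux]
def HonestLatticeLimit : Prop :=
  open Literature.MathematicalPhysics.QuantumLattice Literature.MathematicalPhysics.AQFT Literature.MathematicalPhysics.QuantumFieldTheory in let E := EuclideanSpace ℝ (Fin 4); let P := fun (Nf : ℕ) (sch : QCDScheme Nf) (S : LabelledSchwingerFamily (QCDField Nf) E) => ((S.IsNormalized ∧ S.HasLinearGrowth ∧ S.IsSymmetric ∧ (∀ (n : ℕ) (k : Fin n → QCDField Nf) (a : E) (F : SchwartzMap (Fin n → E) ℂ), IsOffDiagonal F → S n k (translateMulti a F) = S n k F) ∧ (∀ (n : ℕ) (k : Fin n → QCDField Nf) (R : E ≃ₗᵢ[ℝ] E), LinearMap.det (R.toLinearEquiv : E →ₗ[ℝ] E) = 1 → (∀ i : Fin 4, ∃ j : Fin 4, R (EuclideanSpace.single i 1) =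 EuclideanSpace.single j 1 ∨ R (EuclideanSpace.single i 1) = -EuclideanSpace.single j 1) → ∀ F : SchwartzMap (Fin n → E) ℂ, IsOffDiagonal F → S n k (linActMulti R F) = S n k F)) ∧ (sch.HasAsymptoticScaling ∧ (∀ fl : Fin Nf, ∀ᶠ k in Filter.atTop, -1 < sch.mq fl k) ∧ (∀ (n : ℕ), n ≠ 0 → ∀ (σ : Fin n → QCDField Nf) (f : Fin n → SchwartzMap E ℝ) (F : SchwartzMap (Fin n → E) ℂ), IsTensorOf F (fun i => ofRealTest (f i)) → IsOffDiagonal F → Filter.Tendsto (fun k : ℕ => qcdLatticeSchwinger sch k n σ f) Filter.atTop (nhds (S n σ F)))) ∧ (∃ Δ : ℝ, 0 < Δ ∧ sch.HasLatticeMassGap Δ)); let NT := fun (Nf : ℕ) (S : LabelledSchwingerFamily (QCDField Nf) E) (s : QCDField Nf) => (∃ (F G : SchwartzMap (Fin 1 → E) ℂ) (H : SchwartzMap (Fin (1 + 1) → E) ℂ), IsTimeOrdered F ∧ IsTimeOrdered G ∧ IsAppendTensorOf H (osAdjoint F) G ∧ S (1 + 1) (fun _ => s) H ≠ S 1 (fun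 _ => s) (osAdjoint F) * S 1 (fun _ => s) G); let NG := fun (Nf : ℕ) (S : LabelledSchwingerFamily (QCDField Nf) E) (s : QCDField Nf) => (∃ (f g h : SchwartzMap E ℂ) (Ffgh : SchwartzMap (Fin 3 → E) ℂ) (Fgh Ffh Ffg : SchwartzMap (Fin 2 → E) ℂ) (Ff Fg Fh : SchwartzMap (Fin 1 → E) ℂ), IsTensorOf Ffgh ![f, g, h] ∧ IsOffDiagonal Ffgh ∧ IsTensorOf Fgh ![g, h] ∧ IsTensorOf Ffh ![f, h] ∧ IsTensorOf Ffg ![f, g] ∧ IsTensorOf Ff ![f] ∧ IsTensorOf Fg ![g] ∧ IsTensorOf Fh ![h] ∧ S 3 (fun _ => s) Ffgh - S 1 (fun _ => s) Ff * S 2 (fun _ => s) Fgh - S 1 (fun _ => s) Fg * S 2 (fun _ => s) Ffh - S 1 (fun _ => s) Fh * S 2 (fun _ => s) Ffg + 2 * (S 1 (fun _ => s) Ff * S 1 (fun _ => s) Fg * S 1 (fun _ => s) Fh) ≠ 0); ∀ Nf : ℕ, (Nf = 2 ∨ Nf = 3) → ∃ reg : QCDRegularisation Nf, reg.HasMassScaling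 ∧ reg.IsChiralAtZero ∧ ∀ m : Fin Nf → ℝ, (∀ f, 0 < m f) → ∃ (z shift : QCDField Nf → ℕ → ℝ) (S : LabelledSchwingerFamily (QCDField Nf) E), P Nf (reg.scheme m z shift) S ∧ NT Nf S QCDField.glue ∧ NG Nf S QCDField.glue ∧ (∀ f g : Fin Nf, f ≠ g → NT Nf S (QCDField.pseudoRe f g))

-- earlier WallDiagonalRP (stmt-QuantumFields-9908, replaced 2026-08-15T16:16:22Z -> stmt-QuantumFields-10466): retired by None — open Literature.MathematicalPhysics.QuantumLattice Literature.MathematicalPhysics.AQFT Literature.MathematicalPhysics.QuantumFieldTheory in let E := EuclideanSpace ℝ (Fin 4); ∀ (Nf : ℕ) (sch : QCDScheme Nf) (S : LabelledSchwingerFamily (QCDField Nf) E), sch.HasAsymptoticSc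
/-- item stmt-QuantumFields-10466 · support · rank 2 · open · by planner
why it might fail: Transparency needs the induced marginal wall mass ψ̄ψ|_W to stay O(g₀²) (untuned rate (log 1/a)^(−5/9)); a wall-critical (layer-Aoki) or bound-state-carrying wall is opaque; the oblique M–M factorisation with links inside B_σ is unrun; torus→wall-box comparison needs b.c.-insensitivity from the gap.
sources: MontvayMunster1994, Symanzik1983, LuscherEtAl1992, SharpeSingleton1998, Aoki1984WilsonPhase, OsterwalderSchrader1973
[crux] (D) THE RP-WALL CRUX, re-typed over the package W (route-repair 2026-08-15, rev 3: rev-1/2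
WallDiagonalRP left 𝔖₀ and axis E2 out of its hypotheses, so QCDHypercubicLimit → ¬WallDiagonalRP by
the degree-0 sign flip 𝔖₀ ↦ −δ_∅ — refuters g40-63 / g41-34, rc0 evidence on
stmt-QuantumFields-9908; it now takes the whole package W of the honest limit, verbatim the W of
QCDBoostCovariance and QCDHypercubicLimit, which `closes` already holds). For every N_f, every
lattice-QCD scheme sch and every labelled Schwinger family S over QCDField N_f with W N_f sch S — E0
(𝔖₀ ≡ 1, hermiticity), E0', axis E2, E3, E4, translation and proper-hypercubic invariance on ⁰𝒮;
two-loop asymptotic scaling, bare Wilson masses eventually on the physical branch m_f(k) > −1,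
convergence of the honest `qcdLatticeSchwinger sch k` to S on off-diagonal tensors (n ≠ 0); a
continuum gap S.HasMassGap Δ and the uniform lattice gap sch.HasLatticeMassGap Δ, Δ > 0 —: S is
reflection positive in pull-back form (tree E2 of n k ↦ 𝔖ₙᵏ ∘ linActMulti R) for every frame R with
R e₀ = a e₀ + b e₁, a² = b² = 1/2 — the four oriented DIAGONAL mirrors x₀ = ±x₁. W pins S on ⁰𝒮
(limits of honest lattice expectations; 𝔖₀ by E0) and -/
@[route_item "route-QuantumFields-TransparentRPWall"]
def WallDiagonalRP : Prop :=
  open Literature.MathematicalPhysics.QuantumLattice Literature.MathematicalPhysics.AQFT Literature.MathematicalPhysics.QuantumFieldTheory in let E := EuclideanSpace ℝ (Fin 4); let W := fun (Nf : ℕ) (sch : QCDScheme Nf) (S : LabelledSchwingerFamily (QCDField Nf) E) => ((S.IsNormalized ∧ S.IsHermitian ∧ S.HasLinearGrowth ∧ S.IsReflectionPositive ∧ S.IsSymmetric ∧ S.HasClusterProperty ∧ (∀ (n : ℕ) (k : Fin n → QCDField Nf) (a : E) (F : SchwartzMap (Fin n → E) ℂ), IsOffDiagonal F → S n k (translateMulti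 a F) = S n k F) ∧ (∀ (n : ℕ) (k : Fin n → QCDField Nf) (R : E ≃ₗᵢ[ℝ] E), LinearMap.det (R.toLinearEquiv : E →ₗ[ℝ] E) = 1 → (∀ i : Fin 4, ∃ j : Fin 4, R (EuclideanSpace.single i 1) = EuclideanSpace.single j 1 ∨ R (EuclideanSpace.single i 1) = -EuclideanSpace.single j 1) → ∀ F : SchwartzMap (Fin n → E) ℂ, IsOffDiagonal F → S n k (linActMulti R F) = S n k F)) ∧ (sch.HasAsymptoticScaling ∧ (∀ fl : Fin Nf, ∀ᶠ k in Filter.atTop, -1 < sch.mq fl k) ∧ (∀ (n : ℕ), n ≠ 0 → ∀ (σ : Fin n → QCDField Nf) (f : Fin n → SchwartzMap E ℝ) (F : SchwartzMap (Fin n → E) ℂ), IsTensorOf F (fun i => ofRealTest (f i)) → IsOffDiagonal F → Filter.Tendsto (fun k : ℕ => qcdLatticeSchwinger sch k n σ f) Filter.atTop (nhds (S n σ F)))) ∧ (∃ Δ : ℝ, 0 < Δ ∧ S.HasMassGap Δ ∧ sch.HasLatticeMassGap Δ)); ∀ (Nf : ℕ) (sch : QCDScheme Nf) (S : LabelledSchwingerFamily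 (QCDField Nf) E), W Nf sch S → ∀ (R : E ≃ₗᵢ[ℝ] E) (a b : ℝ), a ^ 2 = 1 / 2 → b ^ 2 = 1 / 2 → R (EuclideanSpace.single 0 1) = a • EuclideanSpace.single 0 1 + b • EuclideanSpace.single 1 1 → LabelledSchwingerFamily.IsReflectionPositive (fun n (k : Fin n → QCDField Nf) => (S n k).comp (linActMulti R))

/-- item stmt-QuantumFields-9909 · support · rank 3 · open · by planner
why it might fail: Model-blind core is false: Gaussian Ĉ(p)=(1+ε·e₂(p_μ²)²)/(p²+m²) is W(B₄)-invariant, RP across all 16 mirrors, gapped, has the planar cone, yet anisotropic (GFFs: GaierYngvason2000); so everything rests on SCALARITY via W — dim-6 hypercubic admixtures of glue and ψ̄γ₅ψ dying non-perturbatively.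
sources: GaierYngvason2000, Yngvason1994, Borchers1992, Borchers1996, BrunettiGuidoLongo2002, BuchholzEtAl2000
[crux] (B) THE ENGINE — QCD twin of MirrorModularBoosts.CurvatureBoostCovariance (YangMills) for the
FULL species family, since `QCD` cannot renormalise the quark bilinears to zero. For every N_f,
scheme sch and labelled family S carrying the package W (E0, E0', E2, E3, E4; translation and
proper-hypercubic invariance on ⁰𝒮; asymptotic scaling, physical branch and convergence of honest
lattice QCD along sch to S; a continuum gap S.HasMassGap Δ and the uniform lattice gap, Δ > 0): if S
is reflection positive in pull-back form for the eight frames whose time axis is ±e₀, ±e₁, (±e₀ ±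
e₁)/√2 and has the labelled planar spectral cone (verbatim the conclusion of
LabelledPlanarSpectralCone at ι = QCDField N_f), then EVERY species string of S is invariant on ⁰𝒮
under every determinant-one linear isometry fixing e₂ and e₃ (all rotations of the (x₀,x₁)-plane,
all n-point functions, all labels). Intended proof: e₀-reconstruction; cone ⇒ lightlike half-sided
translations + wedge Reeh–Schlieder; wedge standardness (E3 + slit analyticity across the diagonal
mirrors); Borchers1992 / BrunettiGuidoLongo2002 boost relations; geometric action of the three
axis-wedge modular groups closes to a covaria -/
@[route_item "route-QuantumFields-TransparentRPWall"]
def QCDBoostCovariance : Prop :=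
  open Literature.MathematicalPhysics.QuantumLattice Literature.MathematicalPhysics.AQFT Literature.MathematicalPhysics.QuantumFieldTheory in let E := EuclideanSpace ℝ (Fin 4); let W := fun (Nf : ℕ) (sch : QCDScheme Nf) (S : LabelledSchwingerFamily (QCDField Nf) E) => ((S.IsNormalized ∧ S.IsHermitian ∧ S.HasLinearGrowth ∧ S.IsReflectionPositive ∧ S.IsSymmetric ∧ S.HasClusterProperty ∧ (∀ (n : ℕ) (k : Fin n → QCDField Nf) (a : E) (F : SchwartzMap (Fin n → E) ℂ), IsOffDiagonal F → S n k (translateMulti a F) = S n k F) ∧ (∀ (n : ℕ) (k : Fin n → QCDField Nf) (R : E ≃ₗᵢ[ℝ] E), LinearMap.det (R.toLinearEquiv : E →ₗ[ℝ] E) = 1 → (∀ i : Fin 4, ∃ j : Fin 4, R (EuclideanSpace.single i 1) = EuclideanSpace.single j 1 ∨ R (EuclideanSpace.single i 1) = -EuclideanSpace.single j 1) → ∀ F : SchwartzMap (Fin n → E) ℂ, IsOffDiagonal F → S n k (linActMulti R F) = S n k F)) ∧ (sch.HasAsymptoticScaling ∧ (∀ fl : Fin Nf, ∀ᶠ k in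 Filter.atTop, -1 < sch.mq fl k) ∧ (∀ (n : ℕ), n ≠ 0 → ∀ (σ : Fin n → QCDField Nf) (f : Fin n → SchwartzMap E ℝ) (F : SchwartzMap (Fin n → E) ℂ), IsTensorOf F (fun i => ofRealTest (f i)) → IsOffDiagonal F → Filter.Tendsto (fun k : ℕ => qcdLatticeSchwinger sch k n σ f) Filter.atTop (nhds (S n σ F)))) ∧ (∃ Δ : ℝ, 0 < Δ ∧ S.HasMassGap Δ ∧ sch.HasLatticeMassGap Δ)); ∀ (Nf : ℕ) (sch : QCDScheme Nf) (S : LabelledSchwingerFamily (QCDField Nf) E), W Nf sch S → (∀ (R : E ≃ₗᵢ[ℝ] E) (a b : ℝ), a ^ 2 + b ^ 2 = 1 → (a = 0 ∨ b = 0 ∨ a ^ 2 = b ^ 2) → R (EuclideanSpace.single 0 1) = a • EuclideanSpace.single 0 1 + b • EuclideanSpace.single 1 1 → LabelledSchwingerFamily.IsReflectionPositive (fun n (k : Fin n → QCDField Nf) => (S n k).comp (linActMulti R))) → (∀ (n m : ℕ) (k : Fin n → QCDField Nf) (k' : Fin m → QCDField Nf) (F : SchwartzMap (Fin n → E) ℂ)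 (G : SchwartzMap (Fin m → E) ℂ), IsTimeOrdered F → IsTimeOrdered G → ∃ Φ : ℂ × ℂ → ℂ, DifferentiableOn ℂ Φ {w : ℂ × ℂ | |w.2.im| < w.1.re} ∧ (∀ (t b : ℝ), 0 < t → ∀ H : SchwartzMap (Fin (n + m) → E) ℂ, IsAppendTensorOf H (osAdjoint F) (translateMulti (t • EuclideanSpace.single 0 1 + b • EuclideanSpace.single 1 1) G) → Φ ((t : ℂ), (b : ℂ)) = S (n + m) (Fin.append (k ∘ Fin.rev) k') H) ∧ (∀ w ∈ {w : ℂ × ℂ | |w.2.im| < w.1.re}, ∀ (HF : SchwartzMap (Fin (n + n) → E) ℂ) (HG : SchwartzMap (Fin (m + m) → E) ℂ), IsAppendTensorOf HF (osAdjoint F) F → IsAppendTensorOf HG (osAdjoint G) G → ‖Φ w‖ ^ 2 ≤ ‖S (n + n) (Fin.append (k ∘ Fin.rev) k) HF‖ * ‖S (m + m) (Fin.append (k' ∘ Fin.rev) k') HG‖)) → (∀ (R : E ≃ₗᵢ[ℝ] E), LinearMap.det (R.toLinearEquiv : E →ₗ[ℝ] E) = 1 → R (EuclideanSpace.single 2 1)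 = EuclideanSpace.single 2 1 → R (EuclideanSpace.single 3 1) = EuclideanSpace.single 3 1 → ∀ (n : ℕ) (k : Fin n → QCDField Nf) (F : SchwartzMap (Fin n → E) ℂ), IsOffDiagonal F → S n k (linActMulti R F) = S n k F)

/-- item stmt-QuantumFields-9910 · support · rank 4 · closed · proved by Summit.QuantumFields.QCD.Theorems.transparentRPWall_labelledPlanarSpectralCone_proof (prover) · by planner
why it might fail: GJ Cor. 19.5.4 gets |P| ≤ H only via rotations; the diagonal-frame OS spaces differ from the e₀ one, so positivity must be moved by separate holomorphy + the cross theorem, and the UNIFORM contraction bound on all of {|Im β| < Re ζ} needs distributional edge-growth control — may cost an ε of angle.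
sources: OsterwalderSchrader1973, OsterwalderSchrader1975, GlimmJaffe1987, JarnickiPflug2011, FrohlichIsraelLiebSimon1978, arXiv:1802.09037
[crux] (C) MODEL-BLIND, ANY LABEL TYPE — the labelled form of MirrorModularBoosts.PlanarSpectralCone
(which it implies at ι = Unit; one proof serves both routes): a labelled Schwinger family S on ℝ⁴
with E0' (linear growth), E3 (symmetry, labels travelling with arguments) and translation invariance
on ⁰𝒮, reflection positive in pull-back form for every frame R with R e₀ ∈ {a e₀ + b e₁ : a² + b² =
1, a = 0 ∨ b = 0 ∨ a² = b²} (the four mirror LINES x₀ = 0, x₁ = 0, x₀ = ±x₁ of the (x₀,x₁)-plane,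
both sides), has for all time-ordered F (n points, labels k) and G (m points, labels k') a function
Φ holomorphic on {(ζ,β) ∈ ℂ² : |Im β| < Re ζ} with Φ(t,b) = 𝔖_{n+m}^{rev k ++ k'}(ΘF* ⊗ G_{t e₀ + b
e₁}) for t > 0, b ∈ ℝ (any tensor witness) and ‖Φ(ζ,β)‖² ≤ ‖𝔖_{2n}(ΘF* ⊗ F)‖·‖𝔖_{2m}(ΘG* ⊗ G)‖ —
i.e. ⟨Ψ_F, e^(−ζH + iβP₁)Ψ_G⟩ is a contraction family and spec(H, P₁) ⊂ {E ≥ |p₁|} on the OS space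
of ALL species (speed of light exactly 1, forced by the 45° mirrors). Intended proof as in MMB: the
two diagonal RPs give separate holomorphy on a cross in (u, u') = ((x₀+x₁)/√2, (x₀−x₁)/√2);
Siciak–Zaharjuta extends to {|arg u| + |arg u'| < π/2} ⊃ the light cone; Phragmén–Lindelöf +
Paley–Wiener. Labels -/
@[route_item "route-QuantumFields-TransparentRPWall"]
def LabelledPlanarSpectralCone : Prop :=
  open Literature.MathematicalPhysics.QuantumLattice Literature.MathematicalPhysics.AQFT Literature.MathematicalPhysics.QuantumFieldTheory in let E := EuclideanSpace ℝ (Fin 4); ∀ (ι : Type) (S : LabelledSchwingerFamily ι E), S.HasLinearGrowth → S.IsSymmetric → (∀ (n : ℕ) (k : Fin n → ι) (a : E) (F : SchwartzMap (Fin n → E) ℂ), IsOffDiagonal F → S n k (translateMulti a F) = S n k F) → (∀ (R : E ≃ₗᵢ[ℝ] E) (a b : ℝ), a ^ 2 + b ^ 2 = 1 → (a = 0 ∨ b = 0 ∨ a ^ 2 = b ^ 2) → R (EuclideanSpace.single 0 1) = a • EuclideanSpace.single 0 1 + b • EuclideanSpace.single 1 1 → LabelledSchwingerFamily.IsReflectionPositive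 (fun n (k : Fin n → ι) => (S n k).comp (linActMulti R))) → (∀ (n m : ℕ) (k : Fin n → ι) (k' : Fin m → ι) (F : SchwartzMap (Fin n → E) ℂ) (G : SchwartzMap (Fin m → E) ℂ), IsTimeOrdered F → IsTimeOrdered G → ∃ Φ : ℂ × ℂ → ℂ, DifferentiableOn ℂ Φ {w : ℂ × ℂ | |w.2.im| < w.1.re} ∧ (∀ (t b : ℝ), 0 < t → ∀ H : SchwartzMap (Fin (n + m) → E) ℂ, IsAppendTensorOf H (osAdjoint F) (translateMulti (t • EuclideanSpace.single 0 1 + b • EuclideanSpace.single 1 1) G) → Φ ((t : ℂ), (b : ℂ)) = S (n + m) (Fin.append (k ∘ Fin.rev) k') H) ∧ (∀ w ∈ {w : ℂ × ℂ | |w.2.im| < w.1.re}, ∀ (HF : SchwartzMap (Fin (n + n) → E) ℂ) (HG : SchwartzMap (Fin (m + m) → E) ℂ), IsAppendTensorOf HF (osAdjoint F) F → IsAppendTensorOf HG (osAdjoint G) G → ‖Φ w‖ ^ 2 ≤ ‖S (n + n) (Fin.append (k ∘ Fin.rev) k) HF‖ * ‖S (m + m) (Fin.append (k' ∘ Fin.rev)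 k') HG‖))

-- `LabelledPlanarSpectralCone` holds: proved by `Summit.QuantumFields.QCD.Theorems.transparentRPWall_labelledPlanarSpectralCone_proof` (its module imports this route file, so no `_holds` link can be stated here).

/-- item stmt-QuantumFields-9911 · support · rank 5 · open · by planner
why it might fail: Only 3⁴–5⁴ × m ∈ {0.3,1,3} checked (kit j001443); M–M's site proof (4.99)–(4.111) uses a γ-basis adapted to ONE axis, while on-wall tangential hops keep γ₂, γ₃ and wall-touching hops lost their γ_t part — an indefinite or non-Hermitian remainder may surface on large/anisotropic boxes or as m ↓ 0.
sources: MontvayMunster1994, Luscher1977, OsterwalderSeiler1978, MenottiPelissetto1987, kit:j001443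
[crux] THE WALL AT U ≡ 1 (card P1, all boxes and masses) — the constructive complement of
FourMirrorsWardE1.NoDiagonalFermionRP in the SAME kernel convention. For every m > 0 and every open
box {0,…,n−1}⁴, n ≥ 3 (wrap-free principal submatrix of the tree's torus `wilsonDirac`, trivial
gauge group, one colour, r = 1), let D_w be the WALL-MODIFIED operator: the entries of the hops
touching W₀ = {x₀ = x₁} in directions 0 and 1 are −½(1 − γ_n) for q = p + e₀ and q = p − e₁, −½(1 +
γ_n) for q = p − e₀ and q = p + e₁ (γ_n = (γ₀ − γ₁)/√2; sign = sign of the normal component of the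
hop), every other entry Wilson's; then the one-particle Osterwalder–Schrader kernel across the
diagonal mirror θ = (x₀ ↔ x₁) with lift γ_n, K((x,α),(y,α')) = −Σ_β D_w⁻¹((y,α'),(θx,β)) (γ_n)_{βα}
on Λ₊ = {x₁ < x₀}, is HERMITIAN and NEGATIVE SEMIDEFINITE — the sign in which the axis control (lift
γ₀) and hence physical reflection positivity appear in this convention (kit j001443), while
NoDiagonalFermionRP denies Hermitian-and-semidefinite for the unmodified operator with ANY lift.
Verified numerically on 3⁴, 4⁴, 5⁴ × m ∈ {0.3, 1, 3} (kit j001443, § Numbers). Intended proof: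
Montvay–Münster (4.100)–(4.111) with ξ_ -/
@[route_item "route-QuantumFields-TransparentRPWall"]
def FreeWallRP : Prop :=
  ∀ (m : ℝ), 0 < m → ∀ R : ℕ, let n : ℕ := R + 3; let ι : (Fin 4 → Fin n) → Literature.Probability.LatticeModels.TorusSite 4 (n + 1) := fun x i => ((x i : ℕ) : ZMod (n + 1)); let D : Matrix ((Fin 4 → Fin n) × Fin 4) ((Fin 4 → Fin n) × Fin 4) ℂ := (Literature.MathematicalPhysics.QuantumLattice.wilsonDirac (L := n + 1) (1 : Unit →* Matrix (Fin 1) (Fin 1) ℂ) (fun _ => ()) m 1).submatrix (fun p => (ι p.1, (0 : Fin 1), p.2)) (fun p => (ι p.1, (0 : Fin 1), p.2)); let γn : Matrix (Fin 4) (Fin 4) ℂ := (((Real.sqrt 2)⁻¹ : ℝ) : ℂ) • (Literature.MathematicalPhysics.QuantumLattice.euclideanGamma 0 - Literature.MathematicalPhysics.QuantumLattice.euclideanGamma 1); let hop : Fin 4 → (Fin 4 → Fin n) → (Fin 4 → Fin n) → Prop := fun μ x y => (∀ ν, ν ≠ μ → y ν = x ν) ∧ (y μ : ℕ) = (x μ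 : ℕ) + 1; let touch : (Fin 4 → Fin n) → (Fin 4 → Fin n) → Prop := fun x y => x 0 = x 1 ∨ y 0 = y 1; let Dw : Matrix ((Fin 4 → Fin n) × Fin 4) ((Fin 4 → Fin n) × Fin 4) ℂ := Matrix.of fun p q => if touch p.1 q.1 ∧ hop 0 p.1 q.1 then -(1 / 2 : ℂ) * ((1 : Matrix (Fin 4) (Fin 4) ℂ) - γn) p.2 q.2 else if touch p.1 q.1 ∧ hop 0 q.1 p.1 then -(1 / 2 : ℂ) * ((1 : Matrix (Fin 4) (Fin 4) ℂ) + γn) p.2 q.2 else if touch p.1 q.1 ∧ hop 1 p.1 q.1 then -(1 / 2 : ℂ) * ((1 : Matrix (Fin 4) (Fin 4) ℂ) + γn) p.2 q.2 else if touch p.1 q.1 ∧ hop 1 q.1 p.1 then -(1 / 2 : ℂ) * ((1 : Matrix (Fin 4) (Fin 4) ℂ) - γn) p.2 q.2 else D p q; let θ : (Fin 4 → Fin n) → (Fin 4 → Fin n) := fun x => x ∘ Equiv.swap (0 : Fin 4) 1; let K : Matrix ({x : Fin 4 → Fin n // x 1 < x 0} × Fin 4) ({x : Fin 4 → Fin n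 // x 1 < x 0} × Fin 4) ℂ := Matrix.of fun p q => -∑ β : Fin 4, Dw⁻¹ (q.1.1, q.2) (θ p.1.1, β) * γn β p.2; K.IsHermitian ∧ ∀ v : {x : Fin 4 → Fin n // x 1 < x 0} × Fin 4 → ℂ, (star v ⬝ᵥ K.mulVec v).re ≤ 0

-- earlier QCDHypercubicLimit (stmt-QuantumFields-9912, replaced 2026-08-16T23:11:39Z -> stmt-QuantumFields-17272): retired by None — open Literature.MathematicalPhysics.QuantumLattice Literature.MathematicalPhysics.AQFT Literature.MathematicalPhysics.QuantumFieldTheory in let E := EuclideanSpace ℝ (Fin 4); let W := fun (Nf : ℕ) (sch : QCDScheme Nf) (S : LabelledSchwingerFamily (QCDField Nf) E) => ((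
/-- item stmt-QuantumFields-17272 · support · rank 6 · open · by planner
why it might fail: Existence-and-gap minus rotations, down to the chiral point: no UV-stable construction of 4D gauge theory with dynamical Wilson fermions exists (Balaban: pure YM only), the volume-uniform lattice gap has no engine, IsChiralAtZero imports Goldstone gaplessness.
sources: JaffeWitten2000, OsterwalderSeiler1978, Seiler1982, MontvayMunster1994, Balaban1989LargeFieldII, BalabanOcarrollSchor1989
[crux] (H) THE EXISTENCE LEG, re-typed 2026-08-16 for the revised Statement (p117723: `QCDOf` gained
the conjunct `reg.IsChiralAtZero`) — still literally `QCD` minus the rotation half of E1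
(FourMirrorsWardE1.QCDModuloRotations plus proper-hypercubic invariance, which the lattice gives for
free; isotropy is OUTPUT on this route). For N_f = 2 and N_f = 3: one mass-independent
regularisation reg with leading-log mass scaling (`reg.HasMassScaling`) which is CHIRAL AT ZERO
(`reg.IsChiralAtZero`: for every ε > 0 some tuple of positive renormalised masses has NO uniform
lattice gap ε — the lattice gap closes as m → 0⁺, pinning the additive offset M₀ of m_crit to the
chiral point; this route's RP-wall/modular engine says nothing about the chiral approach, so the
clause is carried here verbatim, exactly as the Statement demands it of the same reg) such that for
every tuple of positive renormalised masses there are species renormalisations z, shift and a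
labelled Schwinger family S over QCDField N_f with E0 (normalisation, hermiticity), E0', E2, E3, E4,
translation invariance and invariance under the proper signed permutations (W(B₄) ∩ SO(4)) on ⁰𝒮;
two-loop asymptotic scaling, physical bra -/
@[route_item "route-QuantumFields-TransparentRPWall"]
def QCDHypercubicLimit : Prop :=
  open Literature.MathematicalPhysics.QuantumLattice Literature.MathematicalPhysics.AQFT Literature.MathematicalPhysics.QuantumFieldTheory in let E := EuclideanSpace ℝ (Fin 4); let W := fun (Nf : ℕ) (sch : QCDScheme Nf) (S : LabelledSchwingerFamily (QCDField Nf) E) => ((S.IsNormalized ∧ S.IsHermitian ∧ S.HasLinearGrowth ∧ S.IsReflectionPositive ∧ S.IsSymmetric ∧ S.HasClusterProperty ∧ (∀ (n : ℕ) (k : Fin n → QCDField Nf) (a : E) (F : SchwartzMap (Fin n → E) ℂ), IsOffDiagonal F → S n k (translateMulti a F) = S n k F) ∧ (∀ (n : ℕ) (k : Fin n → QCDField Nf) (R : E ≃ₗᵢ[ℝ] E), LinearMap.det (R.toLinearEquiv : E →ₗ[ℝ] E) = 1 → (∀ i : Fin 4, ∃ j : Fin 4, R (EuclideanSpace.single i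 1) = EuclideanSpace.single j 1 ∨ R (EuclideanSpace.single i 1) = -EuclideanSpace.single j 1) → ∀ F : SchwartzMap (Fin n → E) ℂ, IsOffDiagonal F → S n k (linActMulti R F) = S n k F)) ∧ (sch.HasAsymptoticScaling ∧ (∀ fl : Fin Nf, ∀ᶠ k in Filter.atTop, -1 < sch.mq fl k) ∧ (∀ (n : ℕ), n ≠ 0 → ∀ (σ : Fin n → QCDField Nf) (f : Fin n → SchwartzMap E ℝ) (F : SchwartzMap (Fin n → E) ℂ), IsTensorOf F (fun i => ofRealTest (f i)) → IsOffDiagonal F → Filter.Tendsto (fun k : ℕ => qcdLatticeSchwinger sch k n σ f) Filter.atTop (nhds (S n σ F)))) ∧ (∃ Δ : ℝ, 0 < Δ ∧ S.HasMassGap Δ ∧ sch.HasLatticeMassGap Δ)); let NT := fun (Nf : ℕ) (S : LabelledSchwingerFamily (QCDField Nf) E) (s : QCDField Nf) => (∃ (F G : SchwartzMap (Fin 1 → E) ℂ) (H : SchwartzMap (Fin (1 + 1) → E) ℂ), IsTimeOrdered F ∧ IsTimeOrdered G ∧ IsAppendTensorOf H (osAdjoint F) G ∧ S (1 + 1) (fun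 _ => s) H ≠ S 1 (fun _ => s) (osAdjoint F) * S 1 (fun _ => s) G); let NG := fun (Nf : ℕ) (S : LabelledSchwingerFamily (QCDField Nf) E) (s : QCDField Nf) => (∃ (f g h : SchwartzMap E ℂ) (Ffgh : SchwartzMap (Fin 3 → E) ℂ) (Fgh Ffh Ffg : SchwartzMap (Fin 2 → E) ℂ) (Ff Fg Fh : SchwartzMap (Fin 1 → E) ℂ), IsTensorOf Ffgh ![f, g, h] ∧ IsOffDiagonal Ffgh ∧ IsTensorOf Fgh ![g, h] ∧ IsTensorOf Ffh ![f, h] ∧ IsTensorOf Ffg ![f, g] ∧ IsTensorOf Ff ![f] ∧ IsTensorOf Fg ![g] ∧ IsTensorOf Fh ![h] ∧ S 3 (fun _ => s) Ffgh - S 1 (fun _ => s) Ff * S 2 (fun _ => s) Fgh - S 1 (fun _ => s) Fg * S 2 (fun _ => s) Ffh - S 1 (fun _ => s) Fh * S 2 (fun _ => s) Ffg + 2 * (S 1 (fun _ => s) Ff * S 1 (fun _ => s) Fg * S 1 (fun _ => s) Fh) ≠ 0); ∀ Nf : ℕ, (Nf = 2 ∨ Nf = 3) → ∃ reg : QCDRegularisation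 Nf, reg.HasMassScaling ∧ reg.IsChiralAtZero ∧ ∀ m : Fin Nf → ℝ, (∀ f, 0 < m f) → ∃ (z shift : QCDField Nf → ℕ → ℝ) (S : LabelledSchwingerFamily (QCDField Nf) E), W Nf (reg.scheme m z shift) S ∧ NT Nf S QCDField.glue ∧ NG Nf S QCDField.glue ∧ (∀ f g : Fin Nf, f ≠ g → NT Nf S (QCDField.pseudoRe f g))

/-- item stmt-QuantumFields-17996 · support · rank 9 · closed · proved by Summit.QuantumFields.QCD.Theorems.TransparentRPWallDiagonalRPClosureProof.diagonalRPClosure_proof (prover) · by planner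
sources: OsterwalderSchrader1973, OsterwalderSchrader1975, GlimmJaffe1987, FrohlichIsraelLiebSimon1978
[support — PROVABLE NOW (L): the labelled port of the LANDED one-species YangMills theorem
RpClosure.isReflectionPositive_pullback (Theorems/PencilRigidityDiagonalMirrorRPRStubRpClosure.lean,
crux DiagonalMirrorRPR stmt-10604) with its model-specific lattice input abstracted into hypotheses;
an OPEN PIECE with its own skeleton] X_C OF THE BC2 REDIRECT OF WallDiagonalRP — MODEL-BLIND
DIAGONAL RP CLOSURE, ANY LABEL TYPE. For a labelled Schwinger family S over ι on ℝ⁴ with E0 (𝔖₀ ≡ 1)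
and ANY sequence of approximants Λ_k (functionals on real test functions and label strings, one per
step) that (0) equal 1 in degree 0, (1) converge to S on compactly supported real tensors with
pairwise disjoint supports (n ≠ 0) and (2) are EVENTUALLY swap-reflection positive in Gram form on
every finite compactly supported real family in {x₁ < x₀} (verbatim the conclusion currency of
CoverWallRP), and with S invariant on ⁰𝒮 under the proper signed permutations (the W(B₄)∩SO(4)
clause of W, any label type): the pull-back of S by EVERY diagonal frame R, R e₀ = a e₀ + b e₁, a² =
b² = 1/2, is reflection positive — tree E2 of n k ↦ 𝔖ₙᵏ ∘ linActMulti R (canonical frames R e₀ =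
c(e₀ − e₁), c > 0, by the closu -/
@[route_item "route-QuantumFields-TransparentRPWall", crux]
def DiagonalRPClosure : Prop :=
  open Literature.MathematicalPhysics.QuantumLattice Literature.MathematicalPhysics.AQFT Literature.MathematicalPhysics.QuantumFieldTheory Literature.Probability.LatticeModels in let E := EuclideanSpace ℝ (Fin 4); let swapT : SchwartzMap E ℝ → SchwartzMap E ℝ := fun h => SchwartzMap.compCLMOfContinuousLinearEquiv ℝ (LinearIsometryEquiv.piLpCongrLeft 2 ℝ ℝ (Equiv.swap (0 : Fin 4) 1)).toContinuousLinearEquiv h; ∀ (ι : Type) (S : LabelledSchwingerFamily ι E) (Λ : (ℕ → (n : ℕ) → (Fin n → ι) → (Fin n → SchwartzMap E ℝ) → ℂ)), S.IsNormalized → (∀ (n : ℕ) (k : Fin n → ι) (R : E ≃ₗᵢ[ℝ] E), LinearMap.det (R.toLinearEquiv : E →ₗ[ℝ] E) = 1 → (∀ i : Fin 4, ∃ j : Fin 4, R (EuclideanSpace.single i 1) = EuclideanSpace.single j 1 ∨ R (EuclideanSpace.single i 1) = -EuclideanSpace.single j 1) → ∀ F : SchwartzMap (Fin n → E) ℂ,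 IsOffDiagonal F → S n k (linActMulti R F) = S n k F) → (∀ (k : ℕ) (σ : Fin 0 → ι) (f : Fin 0 → SchwartzMap E ℝ), Λ k 0 σ f = 1) → (∀ (n : ℕ), n ≠ 0 → ∀ (σ : Fin n → ι) (f : Fin n → SchwartzMap E ℝ), (∀ i, HasCompactSupport (f i : E → ℝ)) → (∀ i j, i ≠ j → Disjoint (tsupport (f i : E → ℝ)) (tsupport (f j : E → ℝ))) → ∀ F : SchwartzMap (Fin n → E) ℂ, IsTensorOf F (fun i => ofRealTest (f i)) → Filter.Tendsto (fun k : ℕ => Λ k n σ f) Filter.atTop (nhds (S n σ F))) → (∀ (N : ℕ) (c : Fin N → ℂ) (deg : Fin N → ℕ) (lab : (j : Fin N) → Fin (deg j) → ι) (f : (j : Fin N) → Fin (deg j) → SchwartzMap E ℝ), (∀ j l, HasCompactSupport (f j l : E → ℝ) ∧ tsupport (f j l : E → ℝ) ⊆ {y : E | y 1 < y 0}) → ∀ᶠ k in Filter.atTop, let z := ∑ i, ∑ j, starRingEnd ℂ (c i) * c j * Λ k (deg i + deg j) (Fin.append (lab i ∘ Fin.rev) (lab j)) (Fin.append (fun l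 => swapT (f i (Fin.rev l))) (f j)); 0 ≤ z.re ∧ z.im = 0) → ∀ (R : E ≃ₗᵢ[ℝ] E) (a b : ℝ), a ^ 2 = 1 / 2 → b ^ 2 = 1 / 2 → R (EuclideanSpace.single 0 1) = a • EuclideanSpace.single 0 1 + b • EuclideanSpace.single 1 1 → LabelledSchwingerFamily.IsReflectionPositive (fun n (k : Fin n → ι) => (S n k).comp (linActMulti R))

-- `DiagonalRPClosure` holds: proved by `Summit.QuantumFields.QCD.Theorems.TransparentRPWallDiagonalRPClosureProof.diagonalRPClosure_proof` (its module imports this route file, so no `_holds` link can be stated here).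

/-- item stmt-QuantumFields-18093 · support · rank 9 · open · by planner
why it might fail: HasLatticeMassGap bounds FIXED observable pairs with free constants, not the k-dependent renormalised smeared fields (same-rate transfer needs the transfer-matrix spectral reading); RP of the limit needs S->oo before k->oo for the time-PERIODIC torus functional ((-1)^F trace).
sources: OsterwalderSchrader1973, OsterwalderSchrader1975, GlimmJaffe1987, OsterwalderSeiler1978, Luscher1977, Seiler1982
[support — filed as support ONLY because of the 7-crux cap; an OPEN piece (XL) with its own
why-might-fail: HasLatticeMassGap bounds FIXED observable pairs with free constants, not the
k-dependent renormalised smeared fields (same-rate transfer needs the transfer-matrix spectral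
reading); RP of the limit needs S→∞ before k→∞ for the time-PERIODIC torus functional] THE CLOSURE
HALF of QCDHypercubicLimit (piece 2 of 2; universal — model-specific only through the honest lattice
functional). For every N_f, every sequential lattice-QCD scheme sch with two-loop asymptotic scaling
and bare Wilson masses eventually on the physical branch m_f(k) > −1, and every labelled Schwinger
family S over QCDField N_f that is normalised, of linear growth, translation invariant on ⁰𝒮 and IS
the k → ∞ limit of the honest `qcdLatticeSchwinger sch k` on off-diagonal real tensors: every
uniform lattice mass gap Δ > 0 of sch (`HasLatticeMassGap Δ`: all pairs of gauge-invariant local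
lattice observables, free constants, all tori ≥ the scheme's) makes S hermitian (E0), reflection
positive (E2) and clustering (E4) AND gives the species mass gap `S.HasMassGap Δ` at the SAME rate.
Intended proof = the three closu -/
@[route_item "route-QuantumFields-TransparentRPWall", crux]
def GappedLimitClosure : Prop :=
  open Literature.MathematicalPhysics.QuantumLattice Literature.MathematicalPhysics.AQFT Literature.MathematicalPhysics.QuantumFieldTheory in let E := EuclideanSpace ℝ (Fin 4); ∀ (Nf : ℕ) (sch : QCDScheme Nf) (S : LabelledSchwingerFamily (QCDField Nf) E), sch.HasAsymptoticScaling → (∀ fl : Fin Nf, ∀ᶠ k in Filter.atTop, -1 < sch.mq fl k) → S.IsNormalized → S.HasLinearGrowth → (∀ (n : ℕ) (k : Fin n → QCDField Nf) (a : E) (F : SchwartzMap (Fin n → E) ℂ), IsOffDiagonal F → S n k (translateMulti a F) = S n k F) → (∀ (n : ℕ), n ≠ 0 → ∀ (σ : Fin n → QCDField Nf) (f : Fin n → SchwartzMap E ℝ) (F : SchwartzMap (Fin n → E) ℂ), IsTensorOf F (fun i => ofRealTest (f i)) → IsOffDiagonal F → Filter.Tendsto (fun k : ℕ => qcdLatticeSchwinger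 sch k n σ f) Filter.atTop (nhds (S n σ F))) → ∀ Δ : ℝ, 0 < Δ → sch.HasLatticeMassGap Δ → (S.IsHermitian ∧ S.IsReflectionPositive ∧ S.HasClusterProperty ∧ S.HasMassGap Δ)

-- earlier Assembly (stmt-QuantumFields-18094, replaced 2026-08-17T09:57:41Z -> stmt-QuantumFields-17998): retired by None — HonestLatticeLimit → GappedLimitClosure → WallDiagonalRP → LabelledConeDiscSections → LabelledConeChainDensity → QCDSieveInputs → LabelledBoostSieve → QCD
-- earlier Assembly (stmt-QuantumFields-9915, replaced 2026-08-17T08:11:19Z -> stmt-QuantumFields-18094): retired by None — QCDHypercubicLimit → WallDiagonalRP → LabelledPlanarSpectralCone → QCDBoostCovariance → LabelledAxisFrames → PlanarToEuclidean → QCD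
/-- item stmt-QuantumFields-17998 · assembly · rank 1 · closed · proved by Summit.QuantumFields.QCD.Theorems.transparentRPWall_assembly_proof (prover) · by planner
sources: OsterwalderSchrader1975, JaffeWitten2000
[assembly] HonestLatticeLimit → GappedLimitClosure → CoverWallRP → WallTransparency →
DiagonalRPClosure → LabelledConeDiscSections → LabelledConeChainDensity → QCDSieveInputs →
LabelledBoostSieve → QCD — the current leaves of the route (rev 20: the existence and closure halves
of the derived node QCDHypercubicLimit; the three pieces of the derived RP-wall node WallDiagonalRP
— exact swap RP of wall-modified lattice QCD on the 45° cover, wall transparency, model-blind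
diagonal RP closure; the two pieces of the derived planar cone; the two pieces of the derived boost
engine) imply the sub-problem statement QCD := QCDOf 2 ∧ QCDOf 3. Verbatim the type of the deciding
theorem closes (provable now: fun h₁ … h₉ => closes h₁ … h₉). -/
@[route_item "route-QuantumFields-TransparentRPWall"]
def Assembly : Prop :=
  HonestLatticeLimit → GappedLimitClosure → CoverWallRP → WallTransparency → DiagonalRPClosure → LabelledConeDiscSections → LabelledConeChainDensity → QCDSieveInputs → LabelledBoostSieve → QCD

-- `Assembly` holds: proved by `Summit.QuantumFields.QCD.Theorems.transparentRPWall_assembly_proof` (its module imports this route file, so no `_holds` link can be stated here).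

-- records of items no longer active in this route (dropped / restated):
-- earlier PlanarToEuclidean (stmt-QuantumFields-9669, dropped 2026-08-17T08:06:23Z): proved by Summit.QuantumFields.YangMills.Theorems.PlanarToEuclidean_proof @ 26cdd46311db — open Literature.MathematicalPhysics.QuantumLattice Literature.MathematicalPhysics.AQFT Literature.MathematicalPhysics.QuantumFieldTheory in let E := EuclideanSpace ℝ (Fin 4); ∀ (ι : Type) (S : LabelledSchwingerFamily ι (E)), (

/-! D-0027 §2.1 — DECIDING THEOREM (planner-authored via `route open/edit --closes-file`; by planner-cstrat-stmt-QuantumFields-10466-r1-0 2026-08-17T09:54:13Z):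
its hypotheses are this route's items and its conclusion the sub-problem Statement (glue_lint), and it elaborates with this file. -/

@[closes "route-QuantumFields-TransparentRPWall"] theorem closes (hLim : HonestLatticeLimit) (hClos : GappedLimitClosure) (hCover : CoverWallRP) (hTrans : WallTransparency)
    (hRPC : DiagonalRPClosure) (hDisc : LabelledConeDiscSections) (hDense : LabelledConeChainDensity)
    (hInputs : QCDSieveInputs) (hSieve : LabelledBoostSieve) : QCD := by
  -- derived nodes (BC2 redirects, cstrat 17272/9909/9910/10466; proofs in Cruxes/<Node>/): hWall, hHL, hEng, hCone
  have hWall : WallDiagonalRP := by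
    intro Nf sch S hW R a b ha hb hRe0
    obtain ⟨⟨hnorm, hherm, hgrowth, hrp, hsymm, hclus, -, hhyp⟩, ⟨hAF, hbr, hconv⟩, Δ, hΔ, hgap, hlat⟩ := hW
    obtain ⟨Λ₀, hΛ, h0, hcv⟩ :=
      hTrans Nf sch S ⟨hnorm, hherm, hgrowth, hrp, hsymm, hclus⟩ ⟨hAF, hbr, hconv⟩ ⟨Δ, hΔ, hgap, hlat⟩
    exact hRPC _ S Λ₀ hnorm hhyp h0 hcv (hCover Nf sch hAF hbr ⟨Δ, hΔ, hlat⟩ Λ₀ hΛ) R a b ha hb hRe0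
  have hHL : QCDHypercubicLimit := by
    intro Nf hNf
    obtain ⟨reg, hms, hchi, hall⟩ := hLim Nf hNf
    refine ⟨reg, hms, hchi, fun m hm => ?_⟩
    obtain ⟨z, shift, S, ⟨⟨hnorm, hgrowth, hsymm, htr, hhyp⟩, ⟨hAF, hbr, hconv⟩, Δ, hΔ, hlat⟩, hnt, hng, hdyn⟩ :=
      hall m hm
    obtain ⟨hherm, hrp, hclus, hgap⟩ :=
      hClos Nf (reg.scheme m z shift) S hAF hbr hnorm hgrowth htr hconv Δ hΔ hlat
    exact ⟨z, shift, S, ⟨⟨hnorm, hherm, hgrowth, hrp, hsymm, hclus, htr, hhyp⟩, ⟨hAF, hbr, hconv⟩, Δ, hΔ, hgap,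
      hlat⟩, hnt, hng, hdyn⟩
  have hEng : QCDBoostCovariance := by
    intro Nf sch S hW h8 hcone
    have hWpkg := hW
    obtain ⟨⟨hnorm, hherm, hgrowth, hrp, hsymm, hclus, htr, hhyp⟩, -, -⟩ := hW
    obtain ⟨hreg, hgrow⟩ := hInputs Nf sch S hWpkg h8 hcone
    exact hSieve (Literature.MathematicalPhysics.QuantumFieldTheory.QCDField Nf) S hnorm hherm hgrowth hrp hsymm
      hclus htr hhyp h8 hcone hreg hgrow
  have hCone : LabelledPlanarSpectralCone := by
    intro ι S hlg hsym htr hRP n m k k' F G hF hG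
    have hrefl : (fun n (k : Fin n → ι) => (S n k).comp
        (Literature.MathematicalPhysics.QuantumLattice.linActMulti
          (LinearIsometryEquiv.refl ℝ (EuclideanSpace ℝ (Fin 4))))) = S := by
      funext n k
      refine ContinuousLinearMap.ext fun F => ?_
      have hF : Literature.MathematicalPhysics.QuantumLattice.linActMulti
          (LinearIsometryEquiv.refl ℝ (EuclideanSpace ℝ (Fin 4))) F = F := SchwartzMap.ext fun _ => rfl
      rw [ContinuousLinearMap.comp_apply, hF]
    have h : Literature.MathematicalPhysics.QuantumFieldTheory.OSReconstructionNoE1 S := by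
      refine ⟨?_, fun n k a F hF => htr n k a F hF⟩
      have h1 := hRP (LinearIsometryEquiv.refl ℝ _) 1 0 (by norm_num) (Or.inr (Or.inl rfl)) (by simp)
      rwa [hrefl] at h1
    have hmeas : MeasurableSet {p : EuclideanSpace ℝ (Fin 4) | p 0 < |p 1|} := by
      have h0 : Continuous fun p : EuclideanSpace ℝ (Fin 4) => p 0 := by fun_prop
      have h1 : Continuous fun p : EuclideanSpace ℝ (Fin 4) => |p 1| := by fun_prop
      exact (isOpen_lt h0 h1).measurableSet
    have hcone : ∀ (ψ : h.Hilbert) (μ : MeasureTheory.Measure (EuclideanSpace ℝ (Fin 4))),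
        h.IsJointSpectralMeasure ψ μ → μ {p | p 0 < |p 1|} = 0 := by
      intro ψ μ hμ
      refine Summit.QuantumFields.YangMills.Cruxes.PlanarSpectralCone.PositivityDiscToOperatorCone.stub_linearity
        h hmeas (hDense ι S h) ?_ ψ μ hμ
      rintro ψ' ⟨m', κ, G', hG', hC, rfl⟩ μ' hμ'
      obtain ⟨c, M, hc, hdisc⟩ := hDisc ι S htr hRP h m' κ G' hG' hC
      haveI := hμ'.isFiniteMeasure
      refine Summit.QuantumFields.YangMills.Cruxes.PlanarSpectralCone.PositivityDiscToOperatorCone.stub_cone_of_discSections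
        μ' hμ'.energy_nonneg c M hc fun t ht => ?_
      obtain ⟨f, hf, hfM, hfb⟩ := hdisc t ht
      refine ⟨f, hf, hfM, fun b hb => ?_⟩
      rw [hfb b hb, hμ'.inner_transfer_translate t (hc.trans_lt ht).le (EuclideanSpace.single 1 b) (by simp)]
      have hinner : ∀ p : EuclideanSpace ℝ (Fin 4),
          inner ℝ (EuclideanSpace.single (1 : Fin 4) b) p = b * p 1 := fun p => by
        simp [EuclideanSpace.inner_single_left]
      simp_rw [hinner]
    obtain ⟨Φ, hΦd, hΦr, hΦb⟩ :=
      Summit.QuantumFields.YangMills.Cruxes.PlanarSpectralCone.PositivityDiscToOperatorCone.Contraction.contractionFamily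
        h hcone (h.fieldVec n k F hF) (h.fieldVec m k' G hG)
    refine ⟨Φ, hΦd, ?_, ?_⟩
    · intro t b ht H hH
      rw [hΦr t b ht, Literature.MathematicalPhysics.QuantumFieldTheory.OSReconstructionNoE1.translate_fieldVec,
        Literature.MathematicalPhysics.QuantumFieldTheory.OSReconstructionNoE1.transfer_fieldVec _ ht.le]
      have hH' : Literature.MathematicalPhysics.QuantumLattice.IsAppendTensorOf H
          (Literature.MathematicalPhysics.QuantumLattice.osAdjoint F)
          (Literature.MathematicalPhysics.QuantumLattice.translateMulti
            (Literature.MathematicalPhysics.QuantumLattice.SchwingerFamily.timeVec t)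
            (Literature.MathematicalPhysics.QuantumLattice.translateMulti
              (Literature.MathematicalPhysics.QuantumFieldTheory.spatialPart 0
                (b • (EuclideanSpace.single 1 1 : EuclideanSpace ℝ (Fin 4)))) G)) := by
        rw [Summit.QuantumFields.YangMills.Cruxes.PlanarSpectralCone.TwoMirrorLightconeSlots.DiscSections.translateMulti_time_space]
        exact hH
      rw [h.inner_fieldVec_fieldVec k k' hF _ hH']
    · intro w hw HF HG hHF hHG
      have hb := hΦb w hw
      have hsq : ∀ {j : ℕ} (κ : Fin j → ι) (A : SchwartzMap (Fin j → EuclideanSpace ℝ (Fin 4)) ℂ)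
          (hA : Literature.MathematicalPhysics.QuantumLattice.IsTimeOrdered A)
          (HA : SchwartzMap (Fin (j + j) → EuclideanSpace ℝ (Fin 4)) ℂ),
          Literature.MathematicalPhysics.QuantumLattice.IsAppendTensorOf HA
              (Literature.MathematicalPhysics.QuantumLattice.osAdjoint A) A →
            ‖S (j + j) (Fin.append (κ ∘ Fin.rev) κ) HA‖ = ‖h.fieldVec j κ A hA‖ ^ 2 := by
        intro j κ A hA HA hHA
        have e := h.inner_fieldVec_fieldVec κ κ hA hA hHA
        rw [← e, inner_self_eq_norm_sq_to_K, norm_pow, RCLike.norm_ofReal, abs_norm]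
      rw [hsq k F hF HF hHF, hsq k' G hG HG hHG, ← mul_pow]
      exact pow_le_pow_left₀ (norm_nonneg _) hb 2
  have hPE : Summit.QuantumFields.YangMills.Theses.PencilRigidity.PlanarToEuclidean :=
    Summit.QuantumFields.YangMills.Theorems.PlanarToEuclidean_proof
  have key : ∀ Nf : ℕ, (Nf = 2 ∨ Nf = 3) → QCDOf Nf := by
    intro Nf hNf
    obtain ⟨reg, hms, hchi, hall⟩ := hHL Nf hNf
    refine ⟨reg, hms, hchi, fun m hm => ?_⟩
    obtain ⟨z, shift, S, hW, hnt, hng, hdyn⟩ := hall m hm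
    have hWpkg := hW
    obtain ⟨⟨hnorm, hherm, hgrowth, hrp, hsymm, hclus, htr, hhyp⟩, ⟨hAF, hbr, hconv⟩, Δ, hΔ, hgap, hlat⟩ := hW
    have hAxis : ∀ (R : EuclideanSpace ℝ (Fin 4) ≃ₗᵢ[ℝ] EuclideanSpace ℝ (Fin 4)) (a b : ℝ), a ^ 2 + b ^ 2 = 1 → (a = 0 ∨ b = 0) →
        R (EuclideanSpace.single 0 1) = a • EuclideanSpace.single 0 1 + b • EuclideanSpace.single 1 1 →
        Literature.MathematicalPhysics.AQFT.LabelledSchwingerFamily.IsReflectionPositive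
          (fun n (k : Fin n → Literature.MathematicalPhysics.QuantumFieldTheory.QCDField Nf) =>
            (S n k).comp (Literature.MathematicalPhysics.QuantumLattice.linActMulti R)) := by
      refine fun R a b hab h0 hR => ?_
      have fixRP : ∀ Q : EuclideanSpace ℝ (Fin 4) ≃ₗᵢ[ℝ] EuclideanSpace ℝ (Fin 4),
          Q (EuclideanSpace.single 0 1) = EuclideanSpace.single 0 1 →
          Literature.MathematicalPhysics.AQFT.LabelledSchwingerFamily.IsReflectionPositive
            (fun n (k : Fin n → Literature.MathematicalPhysics.QuantumFieldTheory.QCDField Nf) => (S n k).comp (Literature.MathematicalPhysics.QuantumLattice.linActMulti Q)) := by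
        intro Q hQ N deg lab F hF H hH
        have h := hrp N deg lab (fun j => Literature.MathematicalPhysics.QuantumLattice.linActMulti Q (F j))
          (fun j => Summit.QuantumFields.YangMills.Theorems.CurvatureChannel.isTimeOrdered_linActMulti_of_map_e0
            hQ (hF j))
          (fun i j => Literature.MathematicalPhysics.QuantumLattice.linActMulti Q (H i j))
          (fun i j => by
            rw [Summit.QuantumFields.YangMills.Theorems.CurvatureChannel.osAdjoint_linActMulti_of_map_e0 hQ]
            exact Summit.QuantumFields.YangMills.Theorems.CurvatureChannel.isAppendTensorOf_linActMulti Q (hH i j))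
        simpa only [ContinuousLinearMap.comp_apply] using h
      have hv : R (EuclideanSpace.single 0 1) = EuclideanSpace.single 0 1 ∨
          (R (EuclideanSpace.single 0 1) = -EuclideanSpace.single 0 1 ∨
            R (EuclideanSpace.single 0 1) = EuclideanSpace.single 1 1 ∨
              R (EuclideanSpace.single 0 1) = -EuclideanSpace.single 1 1) := by
        rcases h0 with rfl | rfl
        · have hb : b * b = 1 := by nlinarith [hab]
          rcases mul_self_eq_one_iff.mp hb with rfl | rfl
          · exact Or.inr (Or.inr (Or.inl (by rw [hR]; simp)))
          · exact Or.inr (Or.inr (Or.inr (by rw [hR]; simp)))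
        · have ha : a * a = 1 := by nlinarith [hab]
          rcases mul_self_eq_one_iff.mp ha with rfl | rfl
          · exact Or.inl (by rw [hR]; simp)
          · exact Or.inr (Or.inl (by rw [hR]; simp))
      rcases hv with hv | hv
      · exact fixRP R hv
      · -- (iii) a proper signed permutation g with g (R e₀) = e₀ drops out on ⁰𝒮; R.trans g fixes e₀
        obtain ⟨g, hdet, hsp, hg⟩ :=
          Summit.QuantumFields.YangMills.Theorems.CurvatureChannel.exists_signedPerm_apply_eq_single_zero hv
        have h := fixRP (R.trans g) (by show g (R _) = _; exact hg)
        intro N deg lab F hF H hH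
        have h' := h N deg lab F hF H hH
        have hkey : ∀ i j, S (deg i + deg j) (Fin.append (lab i ∘ Fin.rev) (lab j))
              (Literature.MathematicalPhysics.QuantumLattice.linActMulti (R.trans g) (H i j)) =
            S (deg i + deg j) (Fin.append (lab i ∘ Fin.rev) (lab j))
              (Literature.MathematicalPhysics.QuantumLattice.linActMulti R (H i j)) := by
          intro i j
          rw [Summit.QuantumFields.YangMills.Theorems.CurvatureChannel.linActMulti_trans]
          exact hhyp _ _ g hdet hsp _
            (Summit.QuantumFields.YangMills.Theorems.CurvatureChannel.isOffDiagonal_linActMulti_of_isAppendTensorOf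
              R (hF i) (hF j) (hH i j))
        simp only [ContinuousLinearMap.comp_apply, hkey] at h'
        simpa only [ContinuousLinearMap.comp_apply] using h'
    have h8 : ∀ (R : EuclideanSpace ℝ (Fin 4) ≃ₗᵢ[ℝ] EuclideanSpace ℝ (Fin 4)) (a b : ℝ), a ^ 2 + b ^ 2 = 1 →
        (a = 0 ∨ b = 0 ∨ a ^ 2 = b ^ 2) →
        R (EuclideanSpace.single 0 1) = a • EuclideanSpace.single 0 1 + b • EuclideanSpace.single 1 1 →
        Literature.MathematicalPhysics.AQFT.LabelledSchwingerFamily.IsReflectionPositive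
          (fun n (k : Fin n → Literature.MathematicalPhysics.QuantumFieldTheory.QCDField Nf) =>
            (S n k).comp (Literature.MathematicalPhysics.QuantumLattice.linActMulti R)) := by
      intro R a b hab hcase hR
      rcases hcase with h0 | h0 | h0
      · exact hAxis R a b hab (Or.inl h0) hR
      · exact hAxis R a b hab (Or.inr h0) hR
      · have ha : a ^ 2 = 1 / 2 := by linarith
        have hb : b ^ 2 = 1 / 2 := by linarith
        exact hWall Nf (reg.scheme m z shift) S hWpkg R a b ha hb hR
    have hcone := hCone _ S hgrowth hsymm htr h8
    have hplanar := hEng Nf (reg.scheme m z shift) S hWpkg h8 hcone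
    have hE1 : S.IsEuclideanInvariant :=
      ⟨htr, fun n k R hdet F hF => hPE _ S hhyp hplanar n k R hdet F hF⟩
    exact ⟨z, shift, ⟨S, hnorm, hherm, hgrowth, hE1, hrp, hsymm, hclus⟩, ⟨hAF, hbr, hconv⟩, hnt, hng, hdyn,
      Δ, hΔ, hgap, hlat⟩
  exact ⟨key 2 (Or.inl rfl), key 3 (Or.inr rfl)⟩

end Summit.QuantumFields.QCD.Theses.TransparentRPWall
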